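import Literature.MathematicalPhysics.QuantumFieldTheory.Balaban1983to89.Node00.OpsYSectEElimStar
import Literature.MathematicalPhysics.QuantumFieldTheory.Balaban1983to89.Node00.OpsYSectEStarRecordP
import Literature.MathematicalPhysics.QuantumFieldTheory.Balaban1983to89.B9Thm311Thm315FacesAtLettersR

/-!
# `Balaban1983to89.B9Thm315SectEStarRepAtLettersR` — [B9] Theorem 3.15 (p. 432) through the (3.185) slot, STAR EDITION: the one-configuration step
# (3.185) ⇒ (3.187) over the star sector `P_Λ^st`, the Λ-restricted middle decay on STAR bonds, `LocalOuterStY` FROM letter-level locality and AT THE STAR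
# RECORD (no residual hypothesis), the vacuous members, the family ∕ record faces at `operatorLayerYSectESt ∕ opsYSectESt` over `bg9Y` and over the
# class-parametric carrier `bg9YR` (incl. the v7 star record `sectEStYOfRecordV7` with locality PROVED; §5b keyed by name to the star records
# `opsYNuStOfRecordV4PE ∕ opsYStOfRecordV4PE` of `Node00/OpsYSectEStarRecordP`), and the honesty guard at the flat star letters

T. Bałaban, *Propagators for lattice gauge theories in a background field*, Commun. Math. Phys. **99** (1985) 389–434 [`Balaban1985BackgroundPropagators`];
star convention of T. Bałaban, *Propagators and renormalization transformations for lattice gauge theories. II*, Commun. Math. Phys. **96** (1984) 223–250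
[`Balaban1984PropagatorsII`], (2.3) p. 224.

statement-level skeleton of published theorems with citation tags; proofs where landed; nothing here is a claim about the Yang–Mills mass gap

THE PRINTED LOCUS (verbatim, p. 432).  *«For Mα₀ sufficiently small the propagator C^{(k)}(Λ) is given by the formula (3.185), and satisfies the bound
|C^{(k)}(Λ; y, y′)| ≦ B₀e^{−δ₀|y−y′|}, y, y′ ∈ Λ (3.187)»*; *«The formula (3.185) implies immediately bounds and an exponential decay»*; p. 427: *«We need
operators with Dirichlet boundary conditions outside some domain Λ of the unit lattice»*; [Balaban1984PropagatorsII] p. 224: *«T_η^{Λ′} ⊂ Λ denotes the subset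
of all bonds with at least one ending point belonging to Λ′»*.

WHY THIS FILE (pub-ymgap bus 2026-08-29: def-Y WORD-L (a′) «STAR EDITION» I.45144, INTENT-67).  dag-n06-m's engine `B9Thm315WholeSectERep ∕ …RepOn` and its
faces (`bound3187_sectE_of_3185_on`, `thm315FullPrinted_sectE_of_3185_on[R]`, `t315_opsYSectE_of_3185_on[R]`) are typed over def-Y's SOURCE Sect. E letters
`SectELettersY` and the source sector `P_Λ = secΛY` (`CkY ∕ rhs3185Y`).  The STAR edition of `C^{(k)}(Λ)` (`Node00.OpsYSectEStar`: `SectELettersStY`, `secΛstY`,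
`CkStY`, `rhs3185stY`, `givenBy3185stY`, `operatorLayerYSectESt ∕ opsYSectESt`) needs the same chain with `P_Λ ↦ P_Λ^st`; every GENERIC ingredient is used BY
NAME (`op_dressed_decay`, `blockMat_mul`, `abs_iSup_ball_le_norm_blockCLM`, `blockCLM_sec_sandwich`, `range_one ∕ rowMass_one_le ∕ colMass_one_le`,
`isPseudoDist_unitDistY`), only the letter-indexed statements are re-typed.

WHAT THIS FILE DOES (definitions + the source proofs re-typed over the star letters):
* §1 the three factors of (3.185), star sector: `outerLstY = P_Λ^st(1 + Dμ)P_Λ^st`, `midSstY = QG̃₂Q*`, `outerRstY = P_Λ^st(1 + μ*D*)P_Λ^st`; `rhs3185stY = oL·mid·oR`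
  (`rfl`), the absorption identities, the sandwiched form, the block identities from `givenBy3185stY`, `abs_ker_CkStY_le`;
* §2 the located schemas ★ `LocalOuterStY x 𝔢 r m_E m_F U` (ranges ∕ masses of the two outer factors), `DecayMidStY` (all pairs) and ★ `DecayMidOnStY x 𝔏 𝔢 B₁ U δ`
  (pairs of STAR bonds only — the middle factor is read between the two `P_Λ^st`), the blocks of the outer factors VANISH off `Λ^st × Λ^st`, and ★★
  `bound3187_sectESt_of_3185_on`: (3.185) + `LocalOuterStY` + `DecayMidOnStY` ⇒ `|C^{(k)}(Λ; U; y, y′)| ≦ B₁e^{2δr}m_Em_F·e^{−δ|y−y′|}` for ALL index bonds;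
* §2b ★★ `localOuterStY_of_letters` — n06-m's `B9Thm315WholeBlocksRect.localOuterY_of_letters` over the star sector: per-`U` range ∕ mass data of `D̄ ∕ μ ∕ μ* ∕ D̄*`
  give `LocalOuterStY x 𝔢 (max 0 (max (r_D + r_μ) (r_{μ*} + r_{D*}))) (1 + m_Dm_μ) (1 + m_{μ*}m_{D*}) U` (ranges add, masses multiply, `P_Λ^st` sandwiches do not
  increase either — the locality algebra `range_comp_le ∕ rowMass_comp_le ∕ colMass_comp_le ∕ range_add ∕ …` BY NAME);
* §2c ★★★ `localOuterStY_ofRecordTC`: at part 3's seven-letter star record `sectELettersStYOfRecordTC x 𝔳 𝔢₀` (norm-one `G`, `G`-valued `V`) `LocalOuterStY` holds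
  with `r = ℓ + 2`, `m_E = m_F = 1 + 4(d+1)ℓ` and NO residual hypothesis (def-Y's letter facts `range₂_DbarY_le ∕ rowMass₂_DbarY_le ∕ range₂_muY_le ∕ rowMass₂_muY_le ∕
  range₂_muTY_le ∕ colMass₂_muTY_le ∕ range₂_DbarTY_le ∕ colMass₂_DbarTY_le` BY NAME) — the `LocalOuterY`-type rows part 3 left to def-Y;
* §3 members without star bonds (every diagonal member, `Λ = ∅`: `not_inΛstY_of_Λ_eq_empty ∕ not_inΛstY_diag`): `P_Λ^st = 0`, both sides of (3.185) vanish, the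
  slot ∕ the outer locality ∕ the restricted decay hold OUTRIGHT;
* §4 ★★ `thm315FullPrinted_sectESt_of_3185_on` (over `bg9Y`, `c35Y`) and ★★ `thm315FullPrinted_sectESt_of_3185_onR` (over `bg9YR 𝔸 G R₁ R₂`, generic class
  constant `c`) at `operatorLayerYSectESt` — displayed slot `givenBy3185stY ∧ hasRWExpCY (𝔴 x) U δ₁ ∧ LocalOuterStY … ∧ DecayMidOnStY …`, OUTPUT δ₀ = δ₁, a₀,
  B₀ = B₁e^{2δ₁r}m_Em_F (`siteKernelR_Ck_operatorLayerYSectESt`, `rfl`);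
* §5 record level (`𝔸 = M_N(ℂ)`, `G = SU(N)`): `t315_opsYSectESt_of_3185_on`, ★★★ `t315_opsYSectESt_of_3185_onR` (generic base family `ops`, letters `𝔏`, star
  letters `𝔢`; the star records `opsYStOfRecordV4E ∕ opsYStOfRecordV7E` (part 2 ∕ 3) and def-Y's `opsYStOfRecordV4PE ∕ opsYNuStOfRecordV4PE` (`Node00.OpsYSectEStarRecordP`)
  are `opsYSectESt` at named `ops ∕ 𝔏 ∕ 𝔢`, so the faces apply to them by `rfl`), `…_regY_iff`; ★★★ `localOuterStY_sectEStYOfRecordV7` (`G ≤ U(N)`, `G`-valued `U`: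
  the star twin of def-Y's `localOuterY_sectEYOfRecordV6`) and ★★★ `t315_opsYSectESt_sectEStYOfRecordV7_of_3185_on[R]` — row 24 at the v7 STAR RECORD with THREE
  displayed conjuncts `givenBy3185stY ∧ hasRWExpCY ∧ DecayMidOnStY`, the outer locality PROVED (the star twin of the N06 certificate's `have t315 := t315_opsYSectE_of_3185_onR
  … (localOuterY_sectEYOfRecordV6 …)` step, `R₁` `SU(N)`-valued via `MemOfFam ∕ mem_of_reg335R`);
* §5b the same row KEYED BY NAME to def-Y's star records of record `opsYNuStOfRecordV4PE ∕ opsYStOfRecordV4PE N θ M⋆ 𝔯 (sectEStYOfRecordV7 N θ M⋆ 𝔢₀) 𝔴 𝔈`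
  (`Node00.OpsYSectEStarRecordP`): ★★★ `t315_opsYNuStOfRecordV4PE_sectEStYOfRecordV7_of_3185_on[R]`, `t315_opsYStOfRecordV4PE_sectEStYOfRecordV7_of_3185_onR` — the objects a
  star N06 certificate displays, one-line instances of §5;
* §6 THE HONESTY GUARD at the FLAT star letters `sectELettersStY_flat`: `outerLstY_flat`, `midSstY_flat`, `localOuterStY_flat`, `decayMidOnStY_flat`, ★ `hyps3185st_flat`.

HONEST SCOPE.  Count-neutral kernel bookkeeping over the star letter record; the (3.185) identity at members WITH star bonds, the decay of `QG̃₂Q*` between star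
bonds (G-B9-10), the outer locality of the genuine star letters and the expansion clause stay DISPLAYED.  Nothing of print asserted; NOT a node discharge (N06 ∕
N08 unmoved), NOT summit progress; one finite lattice programme at fixed ε; nothing continuum ∕ ℝ⁴ ∕ OS ∕ mass gap ∕ Clay.  Cell `pub-ymgap` (D-0062), def-Y owner
lineage (`pub-ymgap-node00-def-Y`, gen 26), 2026-08-29.  Imports `Node00.OpsYSectEElimStar` (STAR EDITION parts 2–3, dag-n08-b for def-Y), def-Y's
`Node00.OpsYSectEStarRecordP` (the star records, for §5b only) and def-Y's `B9Thm311Thm315FacesAtLettersR` (hence `B9Thm315WholeSectERepOn`, `B9Thm315WholeBlocksRect`, `B9Thm314Thm315LayerR`); nothing restated.  Net new unproved facts: 0.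
-/

noncomputable section

namespace Literature.MathematicalPhysics.QuantumFieldTheory.Balaban1983to89.B9Thm315SectEStarRepAtLettersR

open B9 Node00
open B4Sect5Torus (IsPseudoDist)
open B6KLevelCensusIndexV1 (KIdx)
open B9PinMembersKLevelV1 (MemberY geo9Y bg9Y)
open B9PinCarriersKLevelV1 (OperatorLayerY)
open B9PinGeometryKLevelV1 (inΛY unitDistY c35Y kLab)
open B9BackgroundsKLevelV1R (RegFamY bg9YR regY335 regY336 siteKernelR MemOfFam mem_of_reg335R)
open B7Prop2SpecialUnitary (specialUnitaryUnits specialUnitaryUnits_le_unitaryUnits)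
open B7Prop2Explicit (unitaryUnits)
open B9Thm315WholeBlocks (blockCLM blockMat blockMat_apply blockCLM_apply abs_iSup_ball_le_norm_blockCLM)
open B9Thm315WholeBlocksRect (blockCLM₂ blockCLM₂_eq_blockCLM range_one rowMass_one_le colMass_one_le blockCLM_sec_sandwich norm_blockCLM_sec_sandwich_le
  blockCLM_ne_zero_of_sec_sandwich isPseudoDist_tdistK range_add range_comp_le rowMass_add_le rowMass_comp_le colMass_add_le colMass_comp_le)
open B9Thm314GpFlatTorusGeometry (tdistK)
open B9Thm315WholeSectERep (op_dressed_decay blockMat_mul)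
open B9Thm314WholePinGeometry (isPseudoDist_unitDistY)
open scoped Matrix

variable {d ℓ : ℕ} {hd : 1 ≤ d + 1} {hL : Odd (ℓ + 1) ∧ 1 < ℓ + 1} {b₀ b₁ : ℝ} {Mstar : ℕ}
variable {𝔸 : Type} [NormedRing 𝔸] [NormedAlgebra ℂ 𝔸] [CompleteSpace 𝔸]

/-! ## §1 The three factors of (3.185) over the star sector, their absorption identities and block identities -/

section Factors

variable (x : MemberY d ℓ hd hL b₀ b₁ Mstar) (𝔏 : CovLettersY 𝔸 x) (𝔢 : SectELettersStY 𝔸 x)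

/-- **the left outer factor `P_Λ^st(1 + Dμ)P_Λ^st` of (3.185)**, star sector. [cite: Balaban1985BackgroundPropagators, (3.185) p.432, (3.169) p.430; Balaban1984PropagatorsII, (2.3) p.224] -/
def outerLstY : IBondOpY 𝔸 x.toKIdx := fun U => secΛstY 𝔸 x * (1 + 𝔢.Dbar U ∘ₗ 𝔢.mu U) * secΛstY 𝔸 x

/-- **the middle factor `Q(U)G̃₂(U)Q*(U)` of (3.185)** at the star letters (the same formula; `G̃₂` the record's parameter). [cite: Balaban1985BackgroundPropagators, (3.185)–(3.186) p.432, (3.15)–(3.16) p.393] -/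
def midSstY : IBondOpY 𝔸 x.toKIdx := fun U => QY x.toKIdx 𝔏.parB U ∘ₗ 𝔢.Gt2 U ∘ₗ QsY x.toKIdx 𝔏.parB U

/-- **the right outer factor `P_Λ^st(1 + μ*D*)P_Λ^st` of (3.185)**, star sector. [cite: Balaban1985BackgroundPropagators, (3.185) p.432, (3.169) p.430; Balaban1984PropagatorsII, (2.3) p.224] -/
def outerRstY : IBondOpY 𝔸 x.toKIdx := fun U => secΛstY 𝔸 x * (1 + 𝔢.muT U ∘ₗ 𝔢.DbarT U) * secΛstY 𝔸 x

variable {x 𝔏 𝔢}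

/-- the star (3.185) expression IS the triple product (`rfl`). [cite: Balaban1985BackgroundPropagators, (3.185) p.432, bookkeeping] -/
theorem rhs3185stY_eq_mul (U : CfgY 𝔸 x.toKIdx) : rhs3185stY x 𝔏 𝔢 U = outerLstY x 𝔢 U * midSstY x 𝔏 𝔢 U * outerRstY x 𝔢 U := rfl

/-- `P_Λ^st(1 + Dμ)P_Λ^st · P_Λ^st = P_Λ^st(1 + Dμ)P_Λ^st`. [cite: Balaban1985BackgroundPropagators, (3.185) p.432, p.427 (Dirichlet), bookkeeping] -/
theorem outerLstY_mul_secΛstY (U : CfgY 𝔸 x.toKIdx) : outerLstY x 𝔢 U * secΛstY 𝔸 x = outerLstY x 𝔢 U :=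
  mul_secΛstY_mul_secΛstY x _

/-- `P_Λ^st · P_Λ^st(1 + Dμ)P_Λ^st = P_Λ^st(1 + Dμ)P_Λ^st`. [cite: Balaban1985BackgroundPropagators, (3.185) p.432, p.427, bookkeeping] -/
theorem secΛstY_mul_outerLstY (U : CfgY 𝔸 x.toKIdx) : secΛstY 𝔸 x * outerLstY x 𝔢 U = outerLstY x 𝔢 U := by
  show secΛstY 𝔸 x * (secΛstY 𝔸 x * (1 + 𝔢.Dbar U ∘ₗ 𝔢.mu U) * secΛstY 𝔸 x) = _
  rw [← mul_assoc, ← mul_assoc, secΛstY_idem]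
  rfl

/-- `P_Λ^st · P_Λ^st(1 + μ*D*)P_Λ^st = P_Λ^st(1 + μ*D*)P_Λ^st`. [cite: Balaban1985BackgroundPropagators, (3.185) p.432, p.427, bookkeeping] -/
theorem secΛstY_mul_outerRstY (U : CfgY 𝔸 x.toKIdx) : secΛstY 𝔸 x * outerRstY x 𝔢 U = outerRstY x 𝔢 U := by
  show secΛstY 𝔸 x * (secΛstY 𝔸 x * (1 + 𝔢.muT U ∘ₗ 𝔢.DbarT U) * secΛstY 𝔸 x) = _
  rw [← mul_assoc, ← mul_assoc, secΛstY_idem]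
  rfl

/-- `P_Λ^st(1 + μ*D*)P_Λ^st · P_Λ^st = P_Λ^st(1 + μ*D*)P_Λ^st`. [cite: Balaban1985BackgroundPropagators, (3.185) p.432, p.427, bookkeeping] -/
theorem outerRstY_mul_secΛstY (U : CfgY 𝔸 x.toKIdx) : outerRstY x 𝔢 U * secΛstY 𝔸 x = outerRstY x 𝔢 U :=
  mul_secΛstY_mul_secΛstY x _

/-- ★ **THE STAR (3.185) EXPRESSION WITH THE MIDDLE FACTOR SANDWICHED**: `rhs3185stY = P_Λ^st(1 + Dμ)P_Λ^st · (P_Λ^st · QG̃₂Q* · P_Λ^st) · P_Λ^st(1 + μ*D*)P_Λ^st` — only the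
blocks of `QG̃₂Q*` between STAR bonds enter. [cite: Balaban1985BackgroundPropagators, (3.185) p.432; Balaban1984PropagatorsII, (2.3) p.224] -/
theorem rhs3185stY_eq_sandwich (U : CfgY 𝔸 x.toKIdx) :
    rhs3185stY x 𝔏 𝔢 U = outerLstY x 𝔢 U * (secΛstY 𝔸 x * midSstY x 𝔏 𝔢 U * secΛstY 𝔸 x) * outerRstY x 𝔢 U := by
  have h : outerLstY x 𝔢 U * (secΛstY 𝔸 x * midSstY x 𝔏 𝔢 U * secΛstY 𝔸 x) * outerRstY x 𝔢 U =
      (outerLstY x 𝔢 U * secΛstY 𝔸 x) * midSstY x 𝔏 𝔢 U * (secΛstY 𝔸 x * outerRstY x 𝔢 U) := by simp only [mul_assoc]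
  rw [h, outerLstY_mul_secΛstY, secΛstY_mul_outerRstY, rhs3185stY_eq_mul]

variable [FiniteDimensional ℂ 𝔸]

/-- ★ the pinned star (3.185) identity gives the block identity. [cite: Balaban1985BackgroundPropagators, Thm 3.15 (3.185) p.432] -/
theorem blockMat_CkStY_of_givenBy3185stY {U : CfgY 𝔸 x.toKIdx} (h : givenBy3185stY x 𝔏 𝔢 U) :
    blockMat (CkStY x 𝔏 𝔢 U) = blockMat (outerLstY x 𝔢 U) * blockMat (midSstY x 𝔏 𝔢 U) * blockMat (outerRstY x 𝔢 U) := by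
  rw [(givenBy3185stY_iff U).1 h, rhs3185stY_eq_mul, blockMat_mul, blockMat_mul]

/-- ★ … and the block identity with the SANDWICHED middle factor. [cite: Balaban1985BackgroundPropagators, Thm 3.15 (3.185) p.432] -/
theorem blockMat_CkStY_of_givenBy3185stY_sandwich {U : CfgY 𝔸 x.toKIdx} (h : givenBy3185stY x 𝔏 𝔢 U) :
    blockMat (CkStY x 𝔏 𝔢 U) =
      blockMat (outerLstY x 𝔢 U) * blockMat (secΛstY 𝔸 x * midSstY x 𝔏 𝔢 U * secΛstY 𝔸 x) * blockMat (outerRstY x 𝔢 U) := by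
  rw [(givenBy3185stY_iff U).1 h, rhs3185stY_eq_sandwich, blockMat_mul, blockMat_mul]

variable (x 𝔏 𝔢) {G : Subgroup 𝔸ˣ}

/-- ★ **def-Y's KERNEL ENTRY OF THE STAR `C^{(k)}(Λ; U)` IS DOMINATED BY THE BLOCK NORM**: `|C^{(k)}(Λ; U; y, y′)| = sup_{‖E‖≦1} ‖(C^{(k)}(Λ; U)(δ_{y′} ⊗ E))(y)‖ ≦
‖blockMat C^{(k)}(Λ; U) (y, y′)‖`. [cite: Balaban1985BackgroundPropagators, Thm 3.15 (3.187) p.432, p.390 (block norm)] -/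
theorem abs_ker_CkStY_le (U : (bg9Y 𝔸 G x).Cfg) (y y' : (geo9Y x).Site) :
    |(siteKernelOfOp x.toKIdx (bg9Y 𝔸 G x) (fun U => U) (CkStY x 𝔏 𝔢) id id).ker U y y'| ≤ ‖blockMat (CkStY x 𝔏 𝔢 U) y y'‖ :=
  abs_iSup_ball_le_norm_blockCLM (CkStY x 𝔏 𝔢 U) y y'

end Factors

/-! ## §2 The located locality ∕ decay schemas over the star sector and (3.185) ⇒ (3.187) at one configuration -/

section Schemas

variable (x : MemberY d ℓ hd hL b₀ b₁ Mstar) (𝔏 : CovLettersY 𝔸 x) (𝔢 : SectELettersStY 𝔸 x) [FiniteDimensional ℂ 𝔸]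

/-- ★ **THE LOCATED LOCALITY OF THE TWO OUTER FACTORS OF (3.185) AT `U`, STAR SECTOR** along `|y − y′| = unitDistY`: the `(p, q)` block of `P_Λ^st(1 + Dμ)P_Λ^st`
vanishes unless `|p − q| ≦ r` and its rows have mass `Σ_q ‖block(p, q)‖ ≦ m_E`; the `(q, p)` block of `P_Λ^st(1 + μ*D*)P_Λ^st` vanishes unless `|q − p| ≦ r` and its
columns have mass `≦ m_F` («constants depending on d and L only»).  A hypothesis schema on the star Sect. E letters (a finite computation at the genuine ones);
nothing asserted. [cite: Balaban1985BackgroundPropagators, (3.169) p.430, (3.185) p.432; Balaban1984PropagatorsII, (2.3) p.224] -/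
structure LocalOuterStY (r mE mF : ℝ) (U : CfgY 𝔸 x.toKIdx) : Prop where
  rangeL : ∀ p q : IBondY x.toKIdx, blockCLM (outerLstY x 𝔢 U) p q ≠ 0 → unitDistY x p q ≤ r
  rowMassL : ∀ p : IBondY x.toKIdx, ∑ q, ‖blockCLM (outerLstY x 𝔢 U) p q‖ ≤ mE
  rangeR : ∀ q p : IBondY x.toKIdx, blockCLM (outerRstY x 𝔢 U) q p ≠ 0 → unitDistY x q p ≤ r
  colMassR : ∀ p : IBondY x.toKIdx, ∑ q, ‖blockCLM (outerRstY x 𝔢 U) q p‖ ≤ mF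

/-- **THE DECAY OF THE MIDDLE FACTOR `QG̃₂Q*` AT `(U, δ)` FOR ALL PAIRS OF INDEX BONDS** (star letters): `‖block(Q(U)G̃₂(U)Q*(U))(p, q)‖ ≦ B₁e^{−δ|p−q|}`.
A hypothesis schema (G-B9-10). [cite: Balaban1985BackgroundPropagators, (3.186) p.432, Thm 3.7 (3.90) p.409, Thm 3.9 (3.98) p.413] -/
def DecayMidStY (B₁ : ℝ) (U : CfgY 𝔸 x.toKIdx) (δ : ℝ) : Prop :=
  ∀ p q : IBondY x.toKIdx, ‖blockCLM (midSstY x 𝔏 𝔢 U) p q‖ ≤ B₁ * Real.exp (-(δ * unitDistY x p q))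

/-- ★ **THE LOCATED DECAY OF `QG̃₂Q*` BETWEEN STAR BONDS AT `(U, δ)`**: `‖block(Q(U)G̃₂(U)Q*(U))(p, q)‖ ≦ B₁e^{−δ|p−q|}` for `p, q ∈ Λ^st` (the middle factor is
read between the two `P_Λ^st`; weaker than `DecayMidStY`).  A hypothesis schema (G-B9-10). [cite: Balaban1985BackgroundPropagators, (3.186) p.432, Thm 3.15 (3.187) p.432; Balaban1984PropagatorsII, (2.3) p.224] -/
def DecayMidOnStY (B₁ : ℝ) (U : CfgY 𝔸 x.toKIdx) (δ : ℝ) : Prop :=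
  ∀ p q : IBondY x.toKIdx, inΛstY x p → inΛstY x q → ‖blockCLM (midSstY x 𝔏 𝔢 U) p q‖ ≤ B₁ * Real.exp (-(δ * unitDistY x p q))

variable {x 𝔏 𝔢}

/-- the all-pairs schema unfolded. [cite: Balaban1985BackgroundPropagators, (3.186) p.432, bookkeeping] -/
theorem decayMidStY_iff (B₁ : ℝ) (U : CfgY 𝔸 x.toKIdx) (δ : ℝ) :
    DecayMidStY x 𝔏 𝔢 B₁ U δ ↔ ∀ p q : IBondY x.toKIdx, ‖blockCLM (midSstY x 𝔏 𝔢 U) p q‖ ≤ B₁ * Real.exp (-(δ * unitDistY x p q)) := Iff.rfl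

/-- the restricted schema unfolded. [cite: Balaban1985BackgroundPropagators, (3.186) p.432, bookkeeping] -/
theorem decayMidOnStY_iff (B₁ : ℝ) (U : CfgY 𝔸 x.toKIdx) (δ : ℝ) :
    DecayMidOnStY x 𝔏 𝔢 B₁ U δ ↔
      ∀ p q : IBondY x.toKIdx, inΛstY x p → inΛstY x q → ‖blockCLM (midSstY x 𝔏 𝔢 U) p q‖ ≤ B₁ * Real.exp (-(δ * unitDistY x p q)) := Iff.rfl

/-- the all-pairs decay implies the restricted one. [cite: Balaban1985BackgroundPropagators, (3.186) p.432, bookkeeping] -/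
theorem decayMidOnStY_of_decayMidStY {B₁ : ℝ} {U : CfgY 𝔸 x.toKIdx} {δ : ℝ} (h : DecayMidStY x 𝔏 𝔢 B₁ U δ) : DecayMidOnStY x 𝔏 𝔢 B₁ U δ :=
  fun p q _ _ => h p q

/-- **the locality schema from the vanishing phrasing** («`r < |p − q| ⇒ block = 0`» and the two mass bounds). [cite: Balaban1985BackgroundPropagators, (3.169) p.430, bookkeeping] -/
theorem localOuterStY_of_vanish {r mE mF : ℝ} {U : CfgY 𝔸 x.toKIdx}
    (hL0 : ∀ p q : IBondY x.toKIdx, r < unitDistY x p q → blockCLM (outerLstY x 𝔢 U) p q = 0)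
    (hLm : ∀ p : IBondY x.toKIdx, ∑ q, ‖blockCLM (outerLstY x 𝔢 U) p q‖ ≤ mE)
    (hR0 : ∀ q p : IBondY x.toKIdx, r < unitDistY x q p → blockCLM (outerRstY x 𝔢 U) q p = 0)
    (hRm : ∀ p : IBondY x.toKIdx, ∑ q, ‖blockCLM (outerRstY x 𝔢 U) q p‖ ≤ mF) : LocalOuterStY x 𝔢 r mE mF U :=
  ⟨fun p q h => not_lt.1 fun hlt => h (hL0 p q hlt), hLm, fun q p h => not_lt.1 fun hlt => h (hR0 q p hlt), hRm⟩

/-- the blocks of a star-sector sandwich `P_Λ^st·T·P_Λ^st` VANISH OFF `Λ^st × Λ^st`, for ANY `T`. [cite: Balaban1985BackgroundPropagators, p.427, (3.185) p.432; Balaban1984PropagatorsII, (2.3) p.224, bookkeeping] -/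
theorem blockCLM_stSandwich_eq_zero (T : Module.End ℂ (IBondY x.toKIdx → 𝔸)) {p q : IBondY x.toKIdx} (h : ¬ (inΛstY x p ∧ inΛstY x q)) :
    blockCLM (secΛstY 𝔸 x * T * secΛstY 𝔸 x) p q = 0 := by
  rw [show secΛstY 𝔸 x = secY 𝔸 (inΛstY x) from rfl, blockCLM_sec_sandwich, if_neg h]

/-- in particular the blocks of `P_Λ^st(1 + Dμ)P_Λ^st` and `P_Λ^st(1 + μ*D*)P_Λ^st` vanish off `Λ^st × Λ^st`. [cite: Balaban1985BackgroundPropagators, (3.185) p.432, bookkeeping] -/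
theorem blockCLM_outerSt_eq_zero_off (U : CfgY 𝔸 x.toKIdx) {p q : IBondY x.toKIdx} (h : ¬ (inΛstY x p ∧ inΛstY x q)) :
    blockCLM (outerLstY x 𝔢 U) p q = 0 ∧ blockCLM (outerRstY x 𝔢 U) p q = 0 :=
  ⟨blockCLM_stSandwich_eq_zero _ h, blockCLM_stSandwich_eq_zero _ h⟩

open Classical in
/-- the blocks of the sandwiched middle factor: the `(p, q)` block of `QG̃₂Q*` between star bonds, else `0`. [cite: Balaban1985BackgroundPropagators, (3.185)–(3.186) p.432, bookkeeping] -/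
theorem blockCLM_stSandwich_midSstY (U : CfgY 𝔸 x.toKIdx) (p q : IBondY x.toKIdx) :
    blockCLM (secΛstY 𝔸 x * midSstY x 𝔏 𝔢 U * secΛstY 𝔸 x) p q = if inΛstY x p ∧ inΛstY x q then blockCLM (midSstY x 𝔏 𝔢 U) p q else 0 := by
  rw [show secΛstY 𝔸 x = secY 𝔸 (inΛstY x) from rfl, blockCLM_sec_sandwich]

/-- the blocks of the sandwiched middle factor decay for ALL pairs once they decay between star bonds (`B₁ ≧ 0`). [cite: Balaban1985BackgroundPropagators, (3.186) p.432, bookkeeping] -/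
theorem norm_blockCLM_stSandwich_mid_le {B₁ : ℝ} {U : CfgY 𝔸 x.toKIdx} {δ : ℝ} (hB₁ : 0 ≤ B₁) (h : DecayMidOnStY x 𝔏 𝔢 B₁ U δ) (p q : IBondY x.toKIdx) :
    ‖blockCLM (secΛstY 𝔸 x * midSstY x 𝔏 𝔢 U * secΛstY 𝔸 x) p q‖ ≤ B₁ * Real.exp (-(δ * unitDistY x p q)) := by
  rw [blockCLM_stSandwich_midSstY]
  split_ifs with hpq
  · exact h p q hpq.1 hpq.2
  · rw [norm_zero]; positivity

/-- ★★ **(3.185) ⇒ (3.187) AT ONE CONFIGURATION, STAR EDITION** (p. 432 *«The formula (3.185) implies immediately bounds and an exponential decay»*): if the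
star `C^{(k)}(Λ; U)` is given by (3.185) (`givenBy3185stY`), the outer factors are local (`LocalOuterStY … r m_E m_F U`) and the blocks of `QG̃₂Q*(U)` decay between
star bonds at `(B₁, δ)`, then def-Y's kernel satisfies `|C^{(k)}(Λ; U; y, y′)| ≦ B₁e^{2δr}m_Em_F·e^{−δ|y−y′|}` for ALL index bonds `y, y′` (the constants of dag-n06-m's
source edition). [cite: Balaban1985BackgroundPropagators, Thm 3.15 (3.185)–(3.187) p.432, (3.169) p.430; Balaban1984PropagatorsII, (2.3) p.224] -/
theorem bound3187_sectESt_of_3185_on {G : Subgroup 𝔸ˣ} {B₁ δ r mE mF : ℝ} (hB₁ : 0 ≤ B₁) (hδ : 0 ≤ δ) {U : (bg9Y 𝔸 G x).Cfg}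
    (h85 : givenBy3185stY x 𝔏 𝔢 U) (hLoc : LocalOuterStY x 𝔢 r mE mF U) (hS : DecayMidOnStY x 𝔏 𝔢 B₁ U δ) (y y' : (geo9Y x).Site) :
    |(siteKernelOfOp x.toKIdx (bg9Y 𝔸 G x) (fun U => U) (CkStY x 𝔏 𝔢) id id).ker U y y'| ≤
      B₁ * Real.exp (2 * δ * r) * mE * mF * Real.exp (-(δ * unitDistY x y y')) := by
  refine (abs_ker_CkStY_le x 𝔏 𝔢 U y y').trans ?_
  rw [blockMat_CkStY_of_givenBy3185stY_sandwich h85]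
  exact op_dressed_decay (unitDistY x) (isPseudoDist_unitDistY x) _ _ _ hB₁ hδ (norm_blockCLM_stSandwich_mid_le hB₁ hS)
    hLoc.rangeL hLoc.rowMassL hLoc.rangeR hLoc.colMassR y y'

/-- (3.185) ⇒ (3.187) at one configuration from the ALL-PAIRS middle decay, star edition. [cite: Balaban1985BackgroundPropagators, Thm 3.15 (3.185)–(3.187) p.432] -/
theorem bound3187_sectESt_of_3185 {G : Subgroup 𝔸ˣ} {B₁ δ r mE mF : ℝ} (hB₁ : 0 ≤ B₁) (hδ : 0 ≤ δ) {U : (bg9Y 𝔸 G x).Cfg}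
    (h85 : givenBy3185stY x 𝔏 𝔢 U) (hLoc : LocalOuterStY x 𝔢 r mE mF U) (hS : DecayMidStY x 𝔏 𝔢 B₁ U δ) (y y' : (geo9Y x).Site) :
    |(siteKernelOfOp x.toKIdx (bg9Y 𝔸 G x) (fun U => U) (CkStY x 𝔏 𝔢) id id).ker U y y'| ≤
      B₁ * Real.exp (2 * δ * r) * mE * mF * Real.exp (-(δ * unitDistY x y y')) :=
  bound3187_sectESt_of_3185_on hB₁ hδ h85 hLoc (decayMidOnStY_of_decayMidStY hS) y y'

end Schemas

/-! ## §2b `LocalOuterStY` FROM LETTER-LEVEL LOCALITY of `D̄`, `μ`, `μ*`, `D̄*` (n06-m's `localOuterY_of_letters` over the star sector) -/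

section LettersLocality

variable (x : MemberY d ℓ hd hL b₀ b₁ Mstar) (𝔢 : SectELettersStY 𝔸 x) [FiniteDimensional ℂ 𝔸]

/-- ★★ **`LocalOuterStY` FROM LETTER-LEVEL LOCALITY** ((3.169): `μ` is local, `D̄` is one-step), STAR EDITION of n06-m's `localOuterY_of_letters`: place the
index bonds by def-Y's `kLab x` and the sites by a placing `πS` into the k-block labels with p21's `tdistK`; per-`U` range ∕ mass data of the four letters
`𝔢.Dbar U` (range `≤ r_D`, row mass `≤ m_D`), `𝔢.mu U` (range `≤ r_μ`, row mass `≤ m_μ`, `m_μ ≥ 0`), `𝔢.muT U` (range `≤ r_{μ*}`, column mass `≤ m_{μ*} ≥ 0`),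
`𝔢.DbarT U` (range `≤ r_{D*}`, column mass `≤ m_{D*}`) give `LocalOuterStY x 𝔢 r (1 + m_D m_μ) (1 + m_{μ*} m_{D*}) U` with `r = max 0 (max (r_D + r_μ)
(r_{μ*} + r_{D*}))` — ranges add, masses multiply, the identity has range 0 and mass ≤ 1, and the `P_Λ^st` sandwich does not increase either.
[cite: Balaban1985BackgroundPropagators, (3.169) p.430, (3.185) p.432; Balaban1984PropagatorsII, (2.3) p.224] -/
theorem localOuterStY_of_letters (U : CfgY 𝔸 x.toKIdx) (πS : SiteY x.toKIdx → (Fin (d + 1) → ℤ)) {rD rμ rμT rDT mD mμ mμT mDT : ℝ}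
    (hmμ : 0 ≤ mμ) (hmμT : 0 ≤ mμT)
    (hDr : ∀ (p : IBondY x.toKIdx) (s : SiteY x.toKIdx), blockCLM₂ (𝔢.Dbar U) p s ≠ 0 →
      tdistK (ℓ := ℓ) (Mh := x.Mh) (k := x.k) (P := x.P') (kLab x p) (πS s) ≤ rD)
    (hDm : ∀ p : IBondY x.toKIdx, ∑ s, ‖blockCLM₂ (𝔢.Dbar U) p s‖ ≤ mD)
    (hμr : ∀ (s : SiteY x.toKIdx) (q : IBondY x.toKIdx), blockCLM₂ (𝔢.mu U) s q ≠ 0 →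
      tdistK (ℓ := ℓ) (Mh := x.Mh) (k := x.k) (P := x.P') (πS s) (kLab x q) ≤ rμ)
    (hμm : ∀ s : SiteY x.toKIdx, ∑ q, ‖blockCLM₂ (𝔢.mu U) s q‖ ≤ mμ)
    (hμTr : ∀ (p : IBondY x.toKIdx) (s : SiteY x.toKIdx), blockCLM₂ (𝔢.muT U) p s ≠ 0 →
      tdistK (ℓ := ℓ) (Mh := x.Mh) (k := x.k) (P := x.P') (kLab x p) (πS s) ≤ rμT)
    (hμTm : ∀ s : SiteY x.toKIdx, ∑ p, ‖blockCLM₂ (𝔢.muT U) p s‖ ≤ mμT)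
    (hDTr : ∀ (s : SiteY x.toKIdx) (q : IBondY x.toKIdx), blockCLM₂ (𝔢.DbarT U) s q ≠ 0 →
      tdistK (ℓ := ℓ) (Mh := x.Mh) (k := x.k) (P := x.P') (πS s) (kLab x q) ≤ rDT)
    (hDTm : ∀ q : IBondY x.toKIdx, ∑ s, ‖blockCLM₂ (𝔢.DbarT U) s q‖ ≤ mDT) :
    LocalOuterStY x 𝔢 (max 0 (max (rD + rμ) (rμT + rDT))) (1 + mD * mμ) (1 + mμT * mDT) U := by
  have hρ := isPseudoDist_tdistK x
  -- the two inner composites `1 + D̄∘μ`, `1 + μ*∘D̄*` on the index-bond carrier (sector-free: verbatim n06-m's)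
  have hL_range : ∀ p q : IBondY x.toKIdx, blockCLM₂ (1 + 𝔢.Dbar U ∘ₗ 𝔢.mu U) p q ≠ 0 →
      tdistK (ℓ := ℓ) (Mh := x.Mh) (k := x.k) (P := x.P') (kLab x p) (kLab x q) ≤ max 0 (rD + rμ) :=
    range_add (kLab x) (kLab x) (range_one hρ (kLab x)) (range_comp_le hρ (kLab x) πS (kLab x) hDr hμr)
  have hL_mass : ∀ p : IBondY x.toKIdx, ∑ q, ‖blockCLM₂ (1 + 𝔢.Dbar U ∘ₗ 𝔢.mu U) p q‖ ≤ 1 + mD * mμ :=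
    rowMass_add_le rowMass_one_le (rowMass_comp_le hmμ hDm hμm)
  have hR_range : ∀ p q : IBondY x.toKIdx, blockCLM₂ (1 + 𝔢.muT U ∘ₗ 𝔢.DbarT U) p q ≠ 0 →
      tdistK (ℓ := ℓ) (Mh := x.Mh) (k := x.k) (P := x.P') (kLab x p) (kLab x q) ≤ max 0 (rμT + rDT) :=
    range_add (kLab x) (kLab x) (range_one hρ (kLab x)) (range_comp_le hρ (kLab x) πS (kLab x) hμTr hDTr)
  have hR_mass : ∀ q : IBondY x.toKIdx, ∑ p, ‖blockCLM₂ (1 + 𝔢.muT U ∘ₗ 𝔢.DbarT U) p q‖ ≤ 1 + mμT * mDT :=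
    colMass_add_le colMass_one_le (colMass_comp_le hmμT hμTm hDTm)
  -- the `P_Λ^st` sandwich (`secΛstY 𝔸 x = secY 𝔸 (inΛstY x)` by `rfl`) does not increase ranges or masses
  refine ⟨fun p q h => ?_, fun p => ?_, fun q p h => ?_, fun p => ?_⟩
  · have h' := blockCLM_ne_zero_of_sec_sandwich (inΛstY x) (1 + 𝔢.Dbar U ∘ₗ 𝔢.mu U) (z := p) (w := q) h
    rw [← blockCLM₂_eq_blockCLM] at h'
    exact ((hL_range p q h').trans (max_le_max le_rfl (le_max_left _ _)))
  · have hL' : ∑ q, ‖blockCLM (1 + 𝔢.Dbar U ∘ₗ 𝔢.mu U) p q‖ ≤ 1 + mD * mμ := by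
      simpa only [blockCLM₂_eq_blockCLM] using hL_mass p
    calc ∑ q, ‖blockCLM (outerLstY x 𝔢 U) p q‖ ≤ ∑ q, ‖blockCLM (1 + 𝔢.Dbar U ∘ₗ 𝔢.mu U) p q‖ :=
          Finset.sum_le_sum fun q _ => norm_blockCLM_sec_sandwich_le (inΛstY x) _ p q
      _ ≤ 1 + mD * mμ := hL'
  · have h' := blockCLM_ne_zero_of_sec_sandwich (inΛstY x) (1 + 𝔢.muT U ∘ₗ 𝔢.DbarT U) (z := q) (w := p) h
    rw [← blockCLM₂_eq_blockCLM] at h'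
    exact ((hR_range q p h').trans (max_le_max le_rfl (le_max_right _ _)))
  · have hR' : ∑ q, ‖blockCLM (1 + 𝔢.muT U ∘ₗ 𝔢.DbarT U) q p‖ ≤ 1 + mμT * mDT := by
      simpa only [blockCLM₂_eq_blockCLM] using hR_mass p
    calc ∑ q, ‖blockCLM (outerRstY x 𝔢 U) q p‖ ≤ ∑ q, ‖blockCLM (1 + 𝔢.muT U ∘ₗ 𝔢.DbarT U) q p‖ :=
          Finset.sum_le_sum fun q _ => norm_blockCLM_sec_sandwich_le (inΛstY x) _ q p
      _ ≤ 1 + mμT * mDT := hR'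

end LettersLocality

/-! ## §2c `LocalOuterStY` AT THE SEVEN-LETTER STAR RECORD `sectELettersStYOfRecordTC x 𝔳 𝔢₀` — NO RESIDUAL HYPOTHESES (norm-one `G`, `G`-valued `V`) -/

section StarRecordLetters

variable (x : MemberY d ℓ hd hL b₀ b₁ Mstar) [FiniteDimensional ℂ 𝔸] {𝔳 : AvY 𝔸 x}

/-- ★★★ **`LocalOuterStY` AT THE STAR RECORD, NO RESIDUAL HYPOTHESES**: for a norm-one structure group `G` and `G`-valued averaged fields `V = 𝔳 U`, part 3's
seven-letter star record `sectELettersStYOfRecordTC x 𝔳 𝔢₀` (whose `μ ∕ D̄ ∕ μ* ∕ D̄*` ARE def-Y's `muY ∕ DbarY ∕ muTY ∕ DbarTY x 𝔳`, `rfl`) satisfies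
`LocalOuterStY` with `r = ℓ + 2`, `m_E = m_F = 1 + 4(d+1)ℓ` — §2b with def-Y's letter-level facts `r_D = r_{D*} = 1`, `m_D = m_{D*} = 2`, `r_μ = r_{μ*} = ℓ + 1`,
`m_μ = m_{μ*} = 2(d+1)ℓ` (`OpsYSectELetters` §9, `OpsYRecordV5` §5); the star twin of def-Y's `localOuterY_ofRecordTC`.
[cite: Balaban1985BackgroundPropagators, (3.185) p.432, (3.168)–(3.169) p.430; Balaban1984PropagatorsII, (2.3) p.224] -/
theorem localOuterStY_ofRecordTC {G : Subgroup 𝔸ˣ} (hG1 : ∀ g ∈ G, ‖((g : 𝔸ˣ) : 𝔸)‖ ≤ 1) (𝔢₀ : SectELettersY 𝔸 x) {U : CfgY 𝔸 x.toKIdx}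
    (h𝔳 : ∀ b, 𝔳 U b ∈ G) :
    LocalOuterStY x (sectELettersStYOfRecordTC x 𝔳 𝔢₀) ((ℓ : ℝ) + 2) (1 + 4 * (((d + 1) * ℓ : ℕ) : ℝ)) (1 + 4 * (((d + 1) * ℓ : ℕ) : ℝ)) U := by
  have h := localOuterStY_of_letters x (sectELettersStYOfRecordTC x 𝔳 𝔢₀) U (πSY x) (rD := 1) (rμ := (ℓ : ℝ) + 1) (rμT := (ℓ : ℝ) + 1) (rDT := 1)
    (mD := 2) (mμ := 2 * (((d + 1) * ℓ : ℕ) : ℝ)) (mμT := 2 * (((d + 1) * ℓ : ℕ) : ℝ)) (mDT := 2) (by positivity) (by positivity)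
    (fun p s hps => range₂_DbarY_le U hps) (rowMass₂_DbarY_le hG1 h𝔳) (fun s q hsq => range₂_muY_le U hsq) (rowMass₂_muY_le hG1 h𝔳)
    (fun p s hps => range₂_muTY_le U hps) (colMass₂_muTY_le hG1 h𝔳) (fun s q hsq => range₂_DbarTY_le U hsq) (colMass₂_DbarTY_le hG1 h𝔳)
  have e1 : max 0 (max ((1 : ℝ) + ((ℓ : ℝ) + 1)) ((ℓ : ℝ) + 1 + 1)) = (ℓ : ℝ) + 2 := by
    rw [show (1 : ℝ) + ((ℓ : ℝ) + 1) = (ℓ : ℝ) + 2 by ring, show (ℓ : ℝ) + 1 + 1 = (ℓ : ℝ) + 2 by ring, max_self,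
      max_eq_right (by positivity)]
  have e2 : (1 : ℝ) + 2 * (2 * (((d + 1) * ℓ : ℕ) : ℝ)) = 1 + 4 * (((d + 1) * ℓ : ℕ) : ℝ) := by ring
  have e3 : (1 : ℝ) + 2 * (((d + 1) * ℓ : ℕ) : ℝ) * 2 = 1 + 4 * (((d + 1) * ℓ : ℕ) : ℝ) := by ring
  rw [e1, e2, e3] at h
  exact h

end StarRecordLetters

/-! ## §3 Members without star bonds (every diagonal member, `Λ = ∅`): the slot, the outer locality and the restricted decay hold OUTRIGHT -/

section NoStar

variable {x : MemberY d ℓ hd hL b₀ b₁ Mstar} (𝔏 : CovLettersY 𝔸 x) (𝔢 : SectELettersStY 𝔸 x)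

omit [NormedAlgebra ℂ 𝔸] [CompleteSpace 𝔸] [NormedRing 𝔸] in
variable (x) in
/-- a good `L`-block meets `Λ`: a member with `Λ = ∅` has NO star bonds. [cite: Balaban1984PropagatorsII, (2.3) p.224; Balaban1985BackgroundPropagators, p.428, bookkeeping] -/
theorem not_inΛstY_of_Λ_eq_empty (hΛ : x.Λ = ∅) (q : IBondY x.toKIdx) : ¬ inΛstY x q := by
  have hgood : ∀ y : USiteY x, ¬ GoodY x y := fun y hy => by
    obtain ⟨z, hz, -⟩ := hy y rfl
    rw [hΛ] at hz
    exact hz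
  exact fun h => h.2.elim (hgood _) (hgood _)

omit [NormedAlgebra ℂ 𝔸] [CompleteSpace 𝔸] [NormedRing 𝔸] in
/-- ★ at a DIAGONAL member (`Λ := ∅`) no bond is a star bond (Thm 3.15 vacuous THERE). [cite: Balaban1985BackgroundPropagators, Thm 3.15 p.432, bookkeeping] -/
theorem not_inΛstY_diag (i : KIdx d ℓ hd hL b₀ b₁) (hcf : i.cf = (((ℓ + 1 : ℕ) : ℝ)) ^ i.k) (hM : Mstar ≤ (ℓ + 1) * i.Mh) (q : IBondY i) :
    ¬ inΛstY (MemberY.diag i hcf hM : MemberY d ℓ hd hL b₀ b₁ Mstar) q :=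
  not_inΛstY_of_Λ_eq_empty (MemberY.diag i hcf hM : MemberY d ℓ hd hL b₀ b₁ Mstar) rfl q

omit [CompleteSpace 𝔸] in
/-- at a member WITHOUT star bonds `P_Λ^st = 0`. [cite: Balaban1985BackgroundPropagators, p.427, bookkeeping] -/
theorem secΛstY_eq_zero (hΛ : ∀ b : IBondY x.toKIdx, ¬ inΛstY x b) : secΛstY 𝔸 x = 0 :=
  B9Thm315WholeSectERepOn.secY_eq_zero_of_forall_not hΛ

/-- … hence the star `C^{(k)}(Λ; U) = 0`. [cite: Balaban1985BackgroundPropagators, (3.158) p.428, bookkeeping] -/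
theorem CkStY_eq_zero_of_forall_not_inΛst (hΛ : ∀ b : IBondY x.toKIdx, ¬ inΛstY x b) (U : CfgY 𝔸 x.toKIdx) : CkStY x 𝔏 𝔢 U = 0 := by
  rw [← secΛstY_mul_CkStY U, secΛstY_eq_zero hΛ, zero_mul]

/-- … and the star (3.185) expression is `0` too. [cite: Balaban1985BackgroundPropagators, (3.185) p.432, bookkeeping] -/
theorem rhs3185stY_eq_zero_of_forall_not_inΛst (hΛ : ∀ b : IBondY x.toKIdx, ¬ inΛstY x b) (U : CfgY 𝔸 x.toKIdx) : rhs3185stY x 𝔏 𝔢 U = 0 := by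
  rw [← secΛstY_mul_rhs3185stY U, secΛstY_eq_zero hΛ, zero_mul]

/-- ★ **AT A MEMBER WITHOUT STAR BONDS THE PINNED STAR (3.185) SLOT HOLDS OUTRIGHT**, for every `U` and all letters. [cite: Balaban1985BackgroundPropagators, Thm 3.15 (3.185) p.432, bookkeeping] -/
theorem givenBy3185stY_of_forall_not_inΛst (hΛ : ∀ b : IBondY x.toKIdx, ¬ inΛstY x b) (U : CfgY 𝔸 x.toKIdx) : givenBy3185stY x 𝔏 𝔢 U := by
  rw [givenBy3185stY_iff, CkStY_eq_zero_of_forall_not_inΛst 𝔏 𝔢 hΛ, rhs3185stY_eq_zero_of_forall_not_inΛst 𝔏 𝔢 hΛ]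

variable [FiniteDimensional ℂ 𝔸]

/-- at a member without star bonds the outer locality holds for any `r` and any masses `m_E, m_F ≧ 0`. [cite: Balaban1985BackgroundPropagators, (3.169) p.430, bookkeeping] -/
theorem localOuterStY_of_forall_not_inΛst (hΛ : ∀ b : IBondY x.toKIdx, ¬ inΛstY x b) {r mE mF : ℝ} (hmE : 0 ≤ mE) (hmF : 0 ≤ mF)
    (U : CfgY 𝔸 x.toKIdx) : LocalOuterStY x 𝔢 r mE mF U := by
  have h0 : ∀ p q : IBondY x.toKIdx, blockCLM (outerLstY x 𝔢 U) p q = 0 ∧ blockCLM (outerRstY x 𝔢 U) p q = 0 :=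
    fun p q => blockCLM_outerSt_eq_zero_off U (fun h => hΛ p h.1)
  refine ⟨fun p q h => absurd (h0 p q).1 h, fun p => ?_, fun q p h => absurd (h0 q p).2 h, fun p => ?_⟩
  · rw [Finset.sum_eq_zero fun q _ => by rw [(h0 p q).1, norm_zero]]; exact hmE
  · rw [Finset.sum_eq_zero fun q _ => by rw [(h0 q p).2, norm_zero]]; exact hmF

/-- at a member without star bonds the restricted middle decay is vacuous. [cite: Balaban1985BackgroundPropagators, (3.186) p.432, bookkeeping] -/
theorem decayMidOnStY_of_forall_not_inΛst (hΛ : ∀ b : IBondY x.toKIdx, ¬ inΛstY x b) (B₁ : ℝ) (U : CfgY 𝔸 x.toKIdx) (δ : ℝ) :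
    DecayMidOnStY x 𝔏 𝔢 B₁ U δ := fun p _ hp _ => absurd hp (hΛ p)

end NoStar

section Diagonal

variable (i : KIdx d ℓ hd hL b₀ b₁) (hcf : i.cf = (((ℓ + 1 : ℕ) : ℝ)) ^ i.k) (hM : Mstar ≤ (ℓ + 1) * i.Mh)

/-- ★ **AT EVERY DIAGONAL MEMBER the star (3.185) slot holds outright.** [cite: Balaban1985BackgroundPropagators, Thm 3.15 (3.185) p.432, bookkeeping] -/
theorem givenBy3185stY_diag (𝔏 : CovLettersY 𝔸 (MemberY.diag i hcf hM : MemberY d ℓ hd hL b₀ b₁ Mstar))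
    (𝔢 : SectELettersStY 𝔸 (MemberY.diag i hcf hM : MemberY d ℓ hd hL b₀ b₁ Mstar)) (U : CfgY 𝔸 i) :
    givenBy3185stY (MemberY.diag i hcf hM : MemberY d ℓ hd hL b₀ b₁ Mstar) 𝔏 𝔢 U :=
  givenBy3185stY_of_forall_not_inΛst 𝔏 𝔢 (not_inΛstY_diag (Mstar := Mstar) i hcf hM) U

variable [FiniteDimensional ℂ 𝔸]

/-- … and so do the outer locality (any `r`, masses `≧ 0`) and the restricted middle decay. [cite: Balaban1985BackgroundPropagators, (3.169) p.430, (3.186) p.432, bookkeeping] -/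
theorem localOuterStY_decayMidOnStY_diag (𝔏 : CovLettersY 𝔸 (MemberY.diag i hcf hM : MemberY d ℓ hd hL b₀ b₁ Mstar))
    (𝔢 : SectELettersStY 𝔸 (MemberY.diag i hcf hM : MemberY d ℓ hd hL b₀ b₁ Mstar)) {r mE mF : ℝ} (hmE : 0 ≤ mE) (hmF : 0 ≤ mF) (B₁ δ : ℝ)
    (U : CfgY 𝔸 i) :
    LocalOuterStY (MemberY.diag i hcf hM : MemberY d ℓ hd hL b₀ b₁ Mstar) 𝔢 r mE mF U ∧
      DecayMidOnStY (MemberY.diag i hcf hM : MemberY d ℓ hd hL b₀ b₁ Mstar) 𝔏 𝔢 B₁ U δ :=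
  ⟨localOuterStY_of_forall_not_inΛst 𝔢 (not_inΛstY_diag (Mstar := Mstar) i hcf hM) hmE hmF U,
    decayMidOnStY_of_forall_not_inΛst 𝔏 𝔢 (not_inΛstY_diag (Mstar := Mstar) i hcf hM) B₁ U δ⟩

end Diagonal

/-! ## §4 ROW 24 at the star Sect. E layer `operatorLayerYSectESt` through the star (3.185) slot — over `bg9Y` and over `bg9YR 𝔸 G R₁ R₂` -/

section Layer

variable [FiniteDimensional ℂ 𝔸] {G : Subgroup 𝔸ˣ}

/-- ★★ **THEOREM 3.15 AS THE WHOLE PRINTED LEAF AT THE STAR SECT. E LAYER THROUGH THE STAR (3.185) SLOT, MIDDLE DECAY ON STAR BONDS ONLY**: from the ONE displayed slot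
`h` — under the printed prefix (`0 < α₀`, `Mα₀ ≦ a₀`, `U` in (3.35)–(3.36)): the star (3.185) identity, the random-walk expansion clause with rate δ₁, the outer locality
`LocalOuterStY r m_E m_F` and the middle decay `DecayMidOnStY B₁ δ₁` — r1's `Thm315FullPrinted` for the layer's `Ck` (kernel rows indexed by `inΛY` pairs), OUTPUT δ₀ = δ₁,
a₀, B₀ = B₁e^{2δ₁r}m_Em_F.  NOT a node discharge. [cite: Balaban1985BackgroundPropagators, Thm 3.15 (3.185)–(3.187) p.432, (3.169) p.430, (3.186) p.432] -/
theorem thm315FullPrinted_sectESt_of_3185_on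
    (ops : ∀ x : MemberY d ℓ hd hL b₀ b₁ Mstar, OperatorLayerY d ℓ hd hL b₀ b₁ Mstar 𝔸 G x)
    (𝔏 : ∀ x : MemberY d ℓ hd hL b₀ b₁ Mstar, CovLettersY 𝔸 x) (𝔢 : ∀ x : MemberY d ℓ hd hL b₀ b₁ Mstar, SectELettersStY 𝔸 x)
    (𝔴 : ∀ x : MemberY d ℓ hd hL b₀ b₁ Mstar, RWLettersEY 𝔸 G x)
    {a₀ δ₁ B₁ r mE mF : ℝ} (ha₀ : 0 < a₀) (hδ₁ : 0 < δ₁) (hB₁ : 0 < B₁) (hmE : 0 < mE) (hmF : 0 < mF)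
    (h : ∀ (x : MemberY d ℓ hd hL b₀ b₁ Mstar) (α₀ : ℝ), 0 < α₀ → (geo9Y x).M * α₀ ≤ a₀ →
      ∀ U : (bg9Y 𝔸 G x).Cfg, (bg9Y 𝔸 G x).Reg335 c35Y α₀ U → (bg9Y 𝔸 G x).Reg336 c35Y α₀ U →
        givenBy3185stY x (𝔏 x) (𝔢 x) U ∧ hasRWExpCY (𝔴 x) U δ₁ ∧
          LocalOuterStY x (𝔢 x) r mE mF U ∧ DecayMidOnStY x (𝔏 x) (𝔢 x) B₁ U δ₁) :
    B9.Thm315FullPrinted c35Y geo9Y (bg9Y 𝔸 G)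
      (fun x => (operatorLayerYSectESt 𝔸 G x (ops x) (𝔏 x) (𝔢 x) (𝔴 x)).Ck) inΛY unitDistY
      (fun x => (operatorLayerYSectESt 𝔸 G x (ops x) (𝔏 x) (𝔢 x) (𝔴 x)).GivenBy3185)
      (fun x => (operatorLayerYSectESt 𝔸 G x (ops x) (𝔏 x) (𝔢 x) (𝔴 x)).HasRWExpC) := by
  refine ⟨δ₁, a₀, B₁ * Real.exp (2 * δ₁ * r) * mE * mF, hδ₁, ha₀, by positivity, fun x α₀ hα hMa U hU hU' => ?_⟩
  obtain ⟨h85, hRW, hLoc, hS⟩ := h x α₀ hα hMa U hU hU'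
  exact ⟨h85, hRW, fun y y' _ _ => bound3187_sectESt_of_3185_on hB₁.le hδ₁.le h85 hLoc hS y y'⟩

variable (R₁ R₂ : RegFamY d ℓ hd hL b₀ b₁ Mstar 𝔸)

omit [FiniteDimensional ℂ 𝔸] in
/-- the re-typed `Ck`-member of the star Sect. E layer IS the index-bond kernel reading of the star `C^{(k)}(Λ; U) = CkStY x 𝔏 𝔢` over `bg9YR R₁ R₂ x` (`rfl`).
[cite: Balaban1985BackgroundPropagators, Thm 3.15 (3.187) p.432, bookkeeping] -/
theorem siteKernelR_Ck_operatorLayerYSectESt (x : MemberY d ℓ hd hL b₀ b₁ Mstar) (ops : OperatorLayerY d ℓ hd hL b₀ b₁ Mstar 𝔸 G x)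
    (𝔏 : CovLettersY 𝔸 x) (𝔢 : SectELettersStY 𝔸 x) (𝔴 : RWLettersEY 𝔸 G x) :
    siteKernelR R₁ R₂ (operatorLayerYSectESt 𝔸 G x ops 𝔏 𝔢 𝔴).Ck =
      siteKernelOfOp x.toKIdx (bg9YR 𝔸 G R₁ R₂ x) (fun U => U) (CkStY x 𝔏 𝔢) id id :=
  rfl

/-- ★★ **THEOREM 3.15 AS THE WHOLE PRINTED LEAF AT THE STAR SECT. E LAYER OVER `bg9YR 𝔸 G R₁ R₂`, THROUGH THE STAR (3.185) SLOT, MIDDLE DECAY ON STAR BONDS ONLY**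
(for every reading of the cube classes and every class constant `c`): the class enters only as the two displayed premises `(bg9YR … x).Reg335 ∕ Reg336 c α₀ U`
(= `R₁ ∕ R₂ x c α₀ U`); the one-configuration step `bound3187_sectESt_of_3185_on` is class-free.  OUTPUT δ₀ = δ₁, a₀, B₀ = B₁e^{2δ₁r}m_Em_F.  NOT a node discharge.
[cite: Balaban1985BackgroundPropagators, Thm 3.15 (3.185)–(3.187) p.432, (3.169) p.430, (3.35)–(3.36) p.396] -/
theorem thm315FullPrinted_sectESt_of_3185_onR
    (ops : ∀ x : MemberY d ℓ hd hL b₀ b₁ Mstar, OperatorLayerY d ℓ hd hL b₀ b₁ Mstar 𝔸 G x)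
    (𝔏 : ∀ x : MemberY d ℓ hd hL b₀ b₁ Mstar, CovLettersY 𝔸 x) (𝔢 : ∀ x : MemberY d ℓ hd hL b₀ b₁ Mstar, SectELettersStY 𝔸 x)
    (𝔴 : ∀ x : MemberY d ℓ hd hL b₀ b₁ Mstar, RWLettersEY 𝔸 G x)
    {c a₀ δ₁ B₁ r mE mF : ℝ} (ha₀ : 0 < a₀) (hδ₁ : 0 < δ₁) (hB₁ : 0 < B₁) (hmE : 0 < mE) (hmF : 0 < mF)
    (h : ∀ (x : MemberY d ℓ hd hL b₀ b₁ Mstar) (α₀ : ℝ), 0 < α₀ → (geo9Y x).M * α₀ ≤ a₀ →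
      ∀ U : (bg9YR 𝔸 G R₁ R₂ x).Cfg, (bg9YR 𝔸 G R₁ R₂ x).Reg335 c α₀ U → (bg9YR 𝔸 G R₁ R₂ x).Reg336 c α₀ U →
        givenBy3185stY x (𝔏 x) (𝔢 x) U ∧ hasRWExpCY (𝔴 x) U δ₁ ∧
          LocalOuterStY x (𝔢 x) r mE mF U ∧ DecayMidOnStY x (𝔏 x) (𝔢 x) B₁ U δ₁) :
    B9.Thm315FullPrinted c geo9Y (bg9YR 𝔸 G R₁ R₂)
      (fun x => siteKernelR R₁ R₂ (operatorLayerYSectESt 𝔸 G x (ops x) (𝔏 x) (𝔢 x) (𝔴 x)).Ck) inΛY unitDistY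
      (fun x => (operatorLayerYSectESt 𝔸 G x (ops x) (𝔏 x) (𝔢 x) (𝔴 x)).GivenBy3185)
      (fun x => (operatorLayerYSectESt 𝔸 G x (ops x) (𝔏 x) (𝔢 x) (𝔴 x)).HasRWExpC) := by
  refine ⟨δ₁, a₀, B₁ * Real.exp (2 * δ₁ * r) * mE * mF, hδ₁, ha₀, by positivity, fun x α₀ hα hMa U hU hU' => ?_⟩
  obtain ⟨h85, hRW, hLoc, hS⟩ := h x α₀ hα hMa U hU hU'
  exact ⟨h85, hRW, fun y y' _ _ => bound3187_sectESt_of_3185_on hB₁.le hδ₁.le h85 hLoc hS y y'⟩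

end Layer

/-! ## §5 Record level (`𝔸 = M_N(ℂ)`, `G = SU(N)`): ROW 24 through the star (3.185) slot at `opsYSectESt N θ M⋆ ops 𝔏 𝔢 𝔴` -/

section Record

open scoped Matrix.Norms.L2Operator

variable (N : ℕ) (θ : Stage3Params) (Mstar' : ℕ)

/-- ★★ **ROW 24 (`t315`) AT THE STAR SECT. E FAMILY `opsYSectESt N θ M⋆ ops 𝔏 𝔢 𝔴` THROUGH THE STAR (3.185) SLOT, MIDDLE DECAY ON STAR BONDS ONLY** (generic base
family, letters and star letters; at def-Y's star records `opsYStOfRecordV4E ∕ opsYStOfRecordV4PE ∕ opsYNuStOfRecordV4PE` by `rfl` on `ops ∕ 𝔏`).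
[cite: Balaban1985BackgroundPropagators, Thm 3.15 (3.185)–(3.187) p.432] -/
theorem t315_opsYSectESt_of_3185_on (ops : OpsY N θ Mstar') (𝔏 : LettersY N θ Mstar') (𝔢 : SectEStY N θ Mstar') (𝔴 : RWEY N θ Mstar')
    {a₀ δ₁ B₁ r mE mF : ℝ} (ha₀ : 0 < a₀) (hδ₁ : 0 < δ₁) (hB₁ : 0 < B₁) (hmE : 0 < mE) (hmF : 0 < mF)
    (h : ∀ (x : MemberY θ.d₆ θ.ℓ₆ θ.hd' θ.hL' θ.b₀ θ.b₁ Mstar') (α₀ : ℝ), 0 < α₀ → (geo9Y x).M * α₀ ≤ a₀ →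
      ∀ U : (bg9Y (Matrix (Fin N) (Fin N) ℂ) (specialUnitaryUnits (Fin N)) x).Cfg,
        (bg9Y (Matrix (Fin N) (Fin N) ℂ) (specialUnitaryUnits (Fin N)) x).Reg335 c35Y α₀ U →
        (bg9Y (Matrix (Fin N) (Fin N) ℂ) (specialUnitaryUnits (Fin N)) x).Reg336 c35Y α₀ U →
          givenBy3185stY x (𝔏 x) (𝔢 x) U ∧ hasRWExpCY (𝔴 x) U δ₁ ∧
            LocalOuterStY x (𝔢 x) r mE mF U ∧ DecayMidOnStY x (𝔏 x) (𝔢 x) B₁ U δ₁) :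
    B9.Thm315FullPrinted c35Y geo9Y (bg9Y (Matrix (Fin N) (Fin N) ℂ) (specialUnitaryUnits (Fin N)))
      (fun x => (opsYSectESt N θ Mstar' ops 𝔏 𝔢 𝔴 x).Ck) inΛY unitDistY
      (fun x => (opsYSectESt N θ Mstar' ops 𝔏 𝔢 𝔴 x).GivenBy3185) (fun x => (opsYSectESt N θ Mstar' ops 𝔏 𝔢 𝔴 x).HasRWExpC) :=
  thm315FullPrinted_sectESt_of_3185_on ops 𝔏 𝔢 𝔴 ha₀ hδ₁ hB₁ hmE hmF h

variable (R₁ R₂ : RegFamY θ.d₆ θ.ℓ₆ θ.hd' θ.hL' θ.b₀ θ.b₁ Mstar' (Matrix (Fin N) (Fin N) ℂ))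

/-- ★★★ **ROW 24 (`t315`) OVER THE CLASS-PARAMETRIC CARRIER AT THE STAR SECT. E FAMILY `opsYSectESt N θ M⋆ ops 𝔏 𝔢 𝔴`, THROUGH THE STAR (3.185) SLOT, MIDDLE
DECAY ON STAR BONDS ONLY, AT GENERIC `(R₁, R₂, c)`** — MODULE 5-R's leaf `t315 : B9.Thm315FullPrinted c geo9Y (bg9YR … R₁ R₂) (fun x => siteKernelR R₁ R₂ (ops x).Ck)
inΛY unitDistY …` at `ops := opsYSectESt …` (the star twin of def-Y's `B9Thm311Thm315FacesAtLettersR.t315_opsYSectE_of_3185_onR`).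
[cite: Balaban1985BackgroundPropagators, Thm 3.15 (3.185)–(3.187) p.432, (3.35)–(3.36) p.396] -/
theorem t315_opsYSectESt_of_3185_onR (ops : OpsY N θ Mstar') (𝔏 : LettersY N θ Mstar') (𝔢 : SectEStY N θ Mstar') (𝔴 : RWEY N θ Mstar')
    {c a₀ δ₁ B₁ r mE mF : ℝ} (ha₀ : 0 < a₀) (hδ₁ : 0 < δ₁) (hB₁ : 0 < B₁) (hmE : 0 < mE) (hmF : 0 < mF)
    (h : ∀ (x : MemberY θ.d₆ θ.ℓ₆ θ.hd' θ.hL' θ.b₀ θ.b₁ Mstar') (α₀ : ℝ), 0 < α₀ → (geo9Y x).M * α₀ ≤ a₀ →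
      ∀ U : (bg9YR (Matrix (Fin N) (Fin N) ℂ) (specialUnitaryUnits (Fin N)) R₁ R₂ x).Cfg,
        (bg9YR (Matrix (Fin N) (Fin N) ℂ) (specialUnitaryUnits (Fin N)) R₁ R₂ x).Reg335 c α₀ U →
        (bg9YR (Matrix (Fin N) (Fin N) ℂ) (specialUnitaryUnits (Fin N)) R₁ R₂ x).Reg336 c α₀ U →
          givenBy3185stY x (𝔏 x) (𝔢 x) U ∧ hasRWExpCY (𝔴 x) U δ₁ ∧
            LocalOuterStY x (𝔢 x) r mE mF U ∧ DecayMidOnStY x (𝔏 x) (𝔢 x) B₁ U δ₁) :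
    B9.Thm315FullPrinted c geo9Y (bg9YR (Matrix (Fin N) (Fin N) ℂ) (specialUnitaryUnits (Fin N)) R₁ R₂)
      (fun x => siteKernelR R₁ R₂ (opsYSectESt N θ Mstar' ops 𝔏 𝔢 𝔴 x).Ck) inΛY unitDistY
      (fun x => (opsYSectESt N θ Mstar' ops 𝔏 𝔢 𝔴 x).GivenBy3185) (fun x => (opsYSectESt N θ Mstar' ops 𝔏 𝔢 𝔴 x).HasRWExpC) :=
  thm315FullPrinted_sectESt_of_3185_onR R₁ R₂ ops 𝔏 𝔢 𝔴 ha₀ hδ₁ hB₁ hmE hmF h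

/-- at MODULE 3's families `(regY335, regY336)` and `c := c35Y` the re-pressed star row 24 IS `t315_opsYSectESt_of_3185_on`'s conclusion (`rfl`).
[cite: Balaban1985BackgroundPropagators, Thm 3.15 (3.187) p.432, bookkeeping] -/
theorem t315_opsYSectESt_of_3185_onR_regY_iff (ops : OpsY N θ Mstar') (𝔏 : LettersY N θ Mstar') (𝔢 : SectEStY N θ Mstar')
    (𝔴 : RWEY N θ Mstar') :
    B9.Thm315FullPrinted c35Y geo9Y
        (bg9YR (Matrix (Fin N) (Fin N) ℂ) (specialUnitaryUnits (Fin N))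
          (regY335 (Matrix (Fin N) (Fin N) ℂ) (specialUnitaryUnits (Fin N)))
          (regY336 (Matrix (Fin N) (Fin N) ℂ) (specialUnitaryUnits (Fin N))))
        (fun x => siteKernelR
          (regY335 (Matrix (Fin N) (Fin N) ℂ) (specialUnitaryUnits (Fin N)))
          (regY336 (Matrix (Fin N) (Fin N) ℂ) (specialUnitaryUnits (Fin N)))
          (opsYSectESt N θ Mstar' ops 𝔏 𝔢 𝔴 x).Ck) inΛY unitDistY
        (fun x => (opsYSectESt N θ Mstar' ops 𝔏 𝔢 𝔴 x).GivenBy3185) (fun x => (opsYSectESt N θ Mstar' ops 𝔏 𝔢 𝔴 x).HasRWExpC) ↔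
      B9.Thm315FullPrinted c35Y geo9Y (bg9Y (Matrix (Fin N) (Fin N) ℂ) (specialUnitaryUnits (Fin N)))
        (fun x => (opsYSectESt N θ Mstar' ops 𝔏 𝔢 𝔴 x).Ck) inΛY unitDistY
        (fun x => (opsYSectESt N θ Mstar' ops 𝔏 𝔢 𝔴 x).GivenBy3185) (fun x => (opsYSectESt N θ Mstar' ops 𝔏 𝔢 𝔴 x).HasRWExpC) :=
  Iff.rfl

variable {R₁ R₂} (𝔢₀ : SectEY N θ Mstar')

/-- ★★★ **`LocalOuterStY` AT THE v7 STAR RECORD `sectEStYOfRecordV7 N θ M⋆ 𝔢₀` — NO RESIDUAL HYPOTHESIS** (`G ≤ U(N)`, `G`-valued `U`; `r = ℓ + 2`,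
`m_E = m_F = 1 + 4(d+1)ℓ`): the star twin of def-Y's `localOuterY_sectEYOfRecordV6`, discharging the `LocalOuterStY` conjunct of §5's row-24 faces at the
star record. [cite: Balaban1985BackgroundPropagators, (3.185) p.432, (3.168)–(3.169) p.430; Balaban1984PropagatorsII, (2.3) p.224] -/
theorem localOuterStY_sectEStYOfRecordV7 (x : MemberY θ.d₆ θ.ℓ₆ θ.hd' θ.hL' θ.b₀ θ.b₁ Mstar')
    {G : Subgroup (Matrix (Fin N) (Fin N) ℂ)ˣ} (hG : G ≤ unitaryUnits (Matrix (Fin N) (Fin N) ℂ))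
    {U : CfgY (Matrix (Fin N) (Fin N) ℂ) x.toKIdx} (hU : ∀ μ z, U μ z ∈ G) :
    LocalOuterStY x (sectEStYOfRecordV7 N θ Mstar' 𝔢₀ x) ((θ.ℓ₆ : ℝ) + 2) (1 + 4 * (((θ.d₆ + 1) * θ.ℓ₆ : ℕ) : ℝ))
      (1 + 4 * (((θ.d₆ + 1) * θ.ℓ₆ : ℕ) : ℝ)) U :=
  localOuterStY_ofRecordTC x (norm_coe_le_one_of_le_unitaryUnits hG) (𝔢₀ x) (fun b => avYOfRecord_mem x hU b)

/-- ★★★ **ROW 24 (`t315`) AT THE v7 STAR RECORD THROUGH THE STAR (3.185) SLOT — THREE DISPLAYED CONJUNCTS** (the star (3.185) identity, the expansion slot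
(3.186), the middle-factor decay between star bonds; `LocalOuterStY` of both outer factors PROVED), MODULE 3's carrier, generic base family `ops` and
letters `𝔏` (at def-Y's records `opsYS349NuOfLetters … ∕ lettersYOfRecordV4P …` by `rfl`): the star twin of def-Y's `t315_opsYOfRecordV6E_of_3185_on`.
[cite: Balaban1985BackgroundPropagators, Thm 3.15 (3.185)–(3.187) p.432, (3.157) p.428, (3.168)–(3.169) p.430; Balaban1984PropagatorsII, (2.3) p.224] -/
theorem t315_opsYSectESt_sectEStYOfRecordV7_of_3185_on (ops : OpsY N θ Mstar') (𝔏 : LettersY N θ Mstar') (𝔴 : RWEY N θ Mstar')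
    {a₀ δ₁ B₁ : ℝ} (ha₀ : 0 < a₀) (hδ₁ : 0 < δ₁) (hB₁ : 0 < B₁)
    (h : ∀ (x : MemberY θ.d₆ θ.ℓ₆ θ.hd' θ.hL' θ.b₀ θ.b₁ Mstar') (α₀ : ℝ), 0 < α₀ → (geo9Y x).M * α₀ ≤ a₀ →
      ∀ U : (bg9Y (Matrix (Fin N) (Fin N) ℂ) (specialUnitaryUnits (Fin N)) x).Cfg,
        (bg9Y (Matrix (Fin N) (Fin N) ℂ) (specialUnitaryUnits (Fin N)) x).Reg335 c35Y α₀ U →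
        (bg9Y (Matrix (Fin N) (Fin N) ℂ) (specialUnitaryUnits (Fin N)) x).Reg336 c35Y α₀ U →
          givenBy3185stY x (𝔏 x) (sectEStYOfRecordV7 N θ Mstar' 𝔢₀ x) U ∧ hasRWExpCY (𝔴 x) U δ₁ ∧
            DecayMidOnStY x (𝔏 x) (sectEStYOfRecordV7 N θ Mstar' 𝔢₀ x) B₁ U δ₁) :
    B9.Thm315FullPrinted c35Y geo9Y (bg9Y (Matrix (Fin N) (Fin N) ℂ) (specialUnitaryUnits (Fin N)))
      (fun x => (opsYSectESt N θ Mstar' ops 𝔏 (sectEStYOfRecordV7 N θ Mstar' 𝔢₀) 𝔴 x).Ck) inΛY unitDistY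
      (fun x => (opsYSectESt N θ Mstar' ops 𝔏 (sectEStYOfRecordV7 N θ Mstar' 𝔢₀) 𝔴 x).GivenBy3185)
      (fun x => (opsYSectESt N θ Mstar' ops 𝔏 (sectEStYOfRecordV7 N θ Mstar' 𝔢₀) 𝔴 x).HasRWExpC) := by
  have hmE : (0 : ℝ) < 1 + 4 * (((θ.d₆ + 1) * θ.ℓ₆ : ℕ) : ℝ) := by positivity
  refine t315_opsYSectESt_of_3185_on N θ Mstar' ops 𝔏 (sectEStYOfRecordV7 N θ Mstar' 𝔢₀) 𝔴 (r := (θ.ℓ₆ : ℝ) + 2) ha₀ hδ₁ hB₁ hmE hmE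
    fun x α₀ hα hMa U hU hU' => ?_
  obtain ⟨h85, hRW, hS⟩ := h x α₀ hα hMa U hU hU'
  exact ⟨h85, hRW, localOuterStY_sectEStYOfRecordV7 N θ Mstar' 𝔢₀ x specialUnitaryUnits_le_unitaryUnits hU.1.1, hS⟩

/-- ★★★ **THE SAME OVER THE CLASS-PARAMETRIC CARRIER `bg9YR … R₁ R₂` AT GENERIC `c`** (the reading family `R₁` `SU(N)`-valued: `MemOfFam`), i.e. the
star twin of the `have t315 := t315_opsYSectE_of_3185_onR …` step of the N06 certificate of record (`BalabanUVNodesN06AtOpsYNuOfRecordV6EPairOT`, edition 65)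
with its `localOuterY_sectEYOfRecordV6` discharge built in. [cite: Balaban1985BackgroundPropagators, Thm 3.15 (3.185)–(3.187) p.432, (3.157) p.428, (3.168)–(3.169) p.430, (3.35)–(3.36) p.396; Balaban1984PropagatorsII, (2.3) p.224] -/
theorem t315_opsYSectESt_sectEStYOfRecordV7_of_3185_onR (hGR : MemOfFam (specialUnitaryUnits (Fin N)) R₁) (ops : OpsY N θ Mstar')
    (𝔏 : LettersY N θ Mstar') (𝔴 : RWEY N θ Mstar') {c a₀ δ₁ B₁ : ℝ} (ha₀ : 0 < a₀) (hδ₁ : 0 < δ₁) (hB₁ : 0 < B₁)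
    (h : ∀ (x : MemberY θ.d₆ θ.ℓ₆ θ.hd' θ.hL' θ.b₀ θ.b₁ Mstar') (α₀ : ℝ), 0 < α₀ → (geo9Y x).M * α₀ ≤ a₀ →
      ∀ U : (bg9YR (Matrix (Fin N) (Fin N) ℂ) (specialUnitaryUnits (Fin N)) R₁ R₂ x).Cfg,
        (bg9YR (Matrix (Fin N) (Fin N) ℂ) (specialUnitaryUnits (Fin N)) R₁ R₂ x).Reg335 c α₀ U →
        (bg9YR (Matrix (Fin N) (Fin N) ℂ) (specialUnitaryUnits (Fin N)) R₁ R₂ x).Reg336 c α₀ U →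
          givenBy3185stY x (𝔏 x) (sectEStYOfRecordV7 N θ Mstar' 𝔢₀ x) U ∧ hasRWExpCY (𝔴 x) U δ₁ ∧
            DecayMidOnStY x (𝔏 x) (sectEStYOfRecordV7 N θ Mstar' 𝔢₀ x) B₁ U δ₁) :
    B9.Thm315FullPrinted c geo9Y (bg9YR (Matrix (Fin N) (Fin N) ℂ) (specialUnitaryUnits (Fin N)) R₁ R₂)
      (fun x => siteKernelR R₁ R₂ (opsYSectESt N θ Mstar' ops 𝔏 (sectEStYOfRecordV7 N θ Mstar' 𝔢₀) 𝔴 x).Ck) inΛY unitDistY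
      (fun x => (opsYSectESt N θ Mstar' ops 𝔏 (sectEStYOfRecordV7 N θ Mstar' 𝔢₀) 𝔴 x).GivenBy3185)
      (fun x => (opsYSectESt N θ Mstar' ops 𝔏 (sectEStYOfRecordV7 N θ Mstar' 𝔢₀) 𝔴 x).HasRWExpC) := by
  have hmE : (0 : ℝ) < 1 + 4 * (((θ.d₆ + 1) * θ.ℓ₆ : ℕ) : ℝ) := by positivity
  refine t315_opsYSectESt_of_3185_onR N θ Mstar' R₁ R₂ ops 𝔏 (sectEStYOfRecordV7 N θ Mstar' 𝔢₀) 𝔴 (r := (θ.ℓ₆ : ℝ) + 2) ha₀ hδ₁ hB₁ hmE hmE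
    fun x α₀ hα hMa U hU hU' => ?_
  obtain ⟨h85, hRW, hS⟩ := h x α₀ hα hMa U hU hU'
  exact ⟨h85, hRW, localOuterStY_sectEStYOfRecordV7 N θ Mstar' 𝔢₀ x specialUnitaryUnits_le_unitaryUnits (mem_of_reg335R hGR x hU), hS⟩

end Record

/-! ## §5b ROW 24 KEYED BY NAME TO def-Y's STAR RECORDS OF RECORD (`Node00/OpsYSectEStarRecordP`): `opsYNuStOfRecordV4PE ∕ opsYStOfRecordV4PE … (sectEStYOfRecordV7 … 𝔢₀) 𝔴 𝔈`,
the exact objects a star N06 certificate displays — one-line instances of §5 (`ops := opsYS349NuOfLetters … (lettersYOfRecordV4P … 𝔯) 𝔈`, `𝔏 := lettersYOfRecordV4P … 𝔯`,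
definitional unfolding of the two record constructors) -/

section RecordKeyed

open scoped Matrix.Norms.L2Operator
open B9Ineq349SiteReading (opsYS349OfLetters)
open B9Eq3132NuReading (opsYS349NuOfLetters)

variable (N : ℕ) (θ : Stage3Params) (Mstar' : ℕ) (𝔯 : ResY N θ Mstar') (𝔢₀ : SectEY N θ Mstar') (𝔴 : RWEY N θ Mstar') (𝔈 : ExpsY N θ Mstar')

/-- ★★★ **ROW 24 AT THE `ν`-READ STAR RECORD `opsYNuStOfRecordV4PE N θ M⋆ 𝔯 (sectEStYOfRecordV7 N θ M⋆ 𝔢₀) 𝔴 𝔈` OVER `bg9Y ∕ c35Y`** from the three displayed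
conjuncts `givenBy3185stY ∧ hasRWExpCY ∧ DecayMidOnStY` at the v4P letters of record, locality PROVED (§5 `t315_opsYSectESt_sectEStYOfRecordV7_of_3185_on` at
`ops := opsYS349NuOfLetters … 𝔈`, `𝔏 := lettersYOfRecordV4P … 𝔯`). [cite: Balaban1985BackgroundPropagators, Thm 3.15 (3.185)–(3.187) p.432, (3.157) p.428] -/
theorem t315_opsYNuStOfRecordV4PE_sectEStYOfRecordV7_of_3185_on {a₀ δ₁ B₁ : ℝ} (ha₀ : 0 < a₀) (hδ₁ : 0 < δ₁) (hB₁ : 0 < B₁)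
    (h : ∀ (x : MemberY θ.d₆ θ.ℓ₆ θ.hd' θ.hL' θ.b₀ θ.b₁ Mstar') (α₀ : ℝ), 0 < α₀ → (geo9Y x).M * α₀ ≤ a₀ →
      ∀ U : (bg9Y (Matrix (Fin N) (Fin N) ℂ) (specialUnitaryUnits (Fin N)) x).Cfg,
        (bg9Y (Matrix (Fin N) (Fin N) ℂ) (specialUnitaryUnits (Fin N)) x).Reg335 c35Y α₀ U →
        (bg9Y (Matrix (Fin N) (Fin N) ℂ) (specialUnitaryUnits (Fin N)) x).Reg336 c35Y α₀ U →
          givenBy3185stY x (lettersYOfRecordV4P N θ Mstar' 𝔯 x) (sectEStYOfRecordV7 N θ Mstar' 𝔢₀ x) U ∧ hasRWExpCY (𝔴 x) U δ₁ ∧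
            DecayMidOnStY x (lettersYOfRecordV4P N θ Mstar' 𝔯 x) (sectEStYOfRecordV7 N θ Mstar' 𝔢₀ x) B₁ U δ₁) :
    B9.Thm315FullPrinted c35Y geo9Y (bg9Y (Matrix (Fin N) (Fin N) ℂ) (specialUnitaryUnits (Fin N)))
      (fun x => (opsYNuStOfRecordV4PE N θ Mstar' 𝔯 (sectEStYOfRecordV7 N θ Mstar' 𝔢₀) 𝔴 𝔈 x).Ck) inΛY unitDistY
      (fun x => (opsYNuStOfRecordV4PE N θ Mstar' 𝔯 (sectEStYOfRecordV7 N θ Mstar' 𝔢₀) 𝔴 𝔈 x).GivenBy3185)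
      (fun x => (opsYNuStOfRecordV4PE N θ Mstar' 𝔯 (sectEStYOfRecordV7 N θ Mstar' 𝔢₀) 𝔴 𝔈 x).HasRWExpC) :=
  t315_opsYSectESt_sectEStYOfRecordV7_of_3185_on N θ Mstar' 𝔢₀ (opsYS349NuOfLetters N θ Mstar' (lettersYOfRecordV4P N θ Mstar' 𝔯) 𝔈)
    (lettersYOfRecordV4P N θ Mstar' 𝔯) 𝔴 ha₀ hδ₁ hB₁ h

variable {R₁ R₂ : RegFamY θ.d₆ θ.ℓ₆ θ.hd' θ.hL' θ.b₀ θ.b₁ Mstar' (Matrix (Fin N) (Fin N) ℂ)}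

/-- ★★★ **ROW 24 AT THE `ν`-READ STAR RECORD `opsYNuStOfRecordV4PE N θ M⋆ 𝔯 (sectEStYOfRecordV7 N θ M⋆ 𝔢₀) 𝔴 𝔈` OVER THE CLASS-PARAMETRIC CARRIER
`bg9YR … R₁ R₂` AT GENERIC `c`** (special-unitary member family `hGR`) from the three displayed conjuncts, locality PROVED — the star twin, keyed by name, of the
N06 certificate of record's `have t315 := t315_opsYSectE_of_3185_onR …` step (edition 65 at `opsYNuOfRecordV4PE … (sectEYOfRecordV6 …)`).
[cite: Balaban1985BackgroundPropagators, Thm 3.15 (3.185)–(3.187) p.432, (3.157) p.428, (3.35)–(3.36) p.396; Balaban1984PropagatorsII, (2.3) p.224] -/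
theorem t315_opsYNuStOfRecordV4PE_sectEStYOfRecordV7_of_3185_onR (hGR : MemOfFam (specialUnitaryUnits (Fin N)) R₁) {c a₀ δ₁ B₁ : ℝ} (ha₀ : 0 < a₀)
    (hδ₁ : 0 < δ₁) (hB₁ : 0 < B₁)
    (h : ∀ (x : MemberY θ.d₆ θ.ℓ₆ θ.hd' θ.hL' θ.b₀ θ.b₁ Mstar') (α₀ : ℝ), 0 < α₀ → (geo9Y x).M * α₀ ≤ a₀ →
      ∀ U : (bg9YR (Matrix (Fin N) (Fin N) ℂ) (specialUnitaryUnits (Fin N)) R₁ R₂ x).Cfg,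
        (bg9YR (Matrix (Fin N) (Fin N) ℂ) (specialUnitaryUnits (Fin N)) R₁ R₂ x).Reg335 c α₀ U →
        (bg9YR (Matrix (Fin N) (Fin N) ℂ) (specialUnitaryUnits (Fin N)) R₁ R₂ x).Reg336 c α₀ U →
          givenBy3185stY x (lettersYOfRecordV4P N θ Mstar' 𝔯 x) (sectEStYOfRecordV7 N θ Mstar' 𝔢₀ x) U ∧ hasRWExpCY (𝔴 x) U δ₁ ∧
            DecayMidOnStY x (lettersYOfRecordV4P N θ Mstar' 𝔯 x) (sectEStYOfRecordV7 N θ Mstar' 𝔢₀ x) B₁ U δ₁) :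
    B9.Thm315FullPrinted c geo9Y (bg9YR (Matrix (Fin N) (Fin N) ℂ) (specialUnitaryUnits (Fin N)) R₁ R₂)
      (fun x => siteKernelR R₁ R₂ (opsYNuStOfRecordV4PE N θ Mstar' 𝔯 (sectEStYOfRecordV7 N θ Mstar' 𝔢₀) 𝔴 𝔈 x).Ck) inΛY unitDistY
      (fun x => (opsYNuStOfRecordV4PE N θ Mstar' 𝔯 (sectEStYOfRecordV7 N θ Mstar' 𝔢₀) 𝔴 𝔈 x).GivenBy3185)
      (fun x => (opsYNuStOfRecordV4PE N θ Mstar' 𝔯 (sectEStYOfRecordV7 N θ Mstar' 𝔢₀) 𝔴 𝔈 x).HasRWExpC) :=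
  t315_opsYSectESt_sectEStYOfRecordV7_of_3185_onR N θ Mstar' 𝔢₀ hGR (opsYS349NuOfLetters N θ Mstar' (lettersYOfRecordV4P N θ Mstar' 𝔯) 𝔈)
    (lettersYOfRecordV4P N θ Mstar' 𝔯) 𝔴 ha₀ hδ₁ hB₁ h

/-- ★★ the same over the class-parametric carrier at the PLAIN star record `opsYStOfRecordV4PE … (sectEStYOfRecordV7 … 𝔢₀) 𝔴 𝔈` (site-(3.49) layer without the
`ν`-read; row 24 does not see rows 25–26). [cite: Balaban1985BackgroundPropagators, Thm 3.15 (3.185)–(3.187) p.432, (3.157) p.428, (3.35)–(3.36) p.396] -/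
theorem t315_opsYStOfRecordV4PE_sectEStYOfRecordV7_of_3185_onR (hGR : MemOfFam (specialUnitaryUnits (Fin N)) R₁) {c a₀ δ₁ B₁ : ℝ} (ha₀ : 0 < a₀)
    (hδ₁ : 0 < δ₁) (hB₁ : 0 < B₁)
    (h : ∀ (x : MemberY θ.d₆ θ.ℓ₆ θ.hd' θ.hL' θ.b₀ θ.b₁ Mstar') (α₀ : ℝ), 0 < α₀ → (geo9Y x).M * α₀ ≤ a₀ →
      ∀ U : (bg9YR (Matrix (Fin N) (Fin N) ℂ) (specialUnitaryUnits (Fin N)) R₁ R₂ x).Cfg,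
        (bg9YR (Matrix (Fin N) (Fin N) ℂ) (specialUnitaryUnits (Fin N)) R₁ R₂ x).Reg335 c α₀ U →
        (bg9YR (Matrix (Fin N) (Fin N) ℂ) (specialUnitaryUnits (Fin N)) R₁ R₂ x).Reg336 c α₀ U →
          givenBy3185stY x (lettersYOfRecordV4P N θ Mstar' 𝔯 x) (sectEStYOfRecordV7 N θ Mstar' 𝔢₀ x) U ∧ hasRWExpCY (𝔴 x) U δ₁ ∧
            DecayMidOnStY x (lettersYOfRecordV4P N θ Mstar' 𝔯 x) (sectEStYOfRecordV7 N θ Mstar' 𝔢₀ x) B₁ U δ₁) :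
    B9.Thm315FullPrinted c geo9Y (bg9YR (Matrix (Fin N) (Fin N) ℂ) (specialUnitaryUnits (Fin N)) R₁ R₂)
      (fun x => siteKernelR R₁ R₂ (opsYStOfRecordV4PE N θ Mstar' 𝔯 (sectEStYOfRecordV7 N θ Mstar' 𝔢₀) 𝔴 𝔈 x).Ck) inΛY unitDistY
      (fun x => (opsYStOfRecordV4PE N θ Mstar' 𝔯 (sectEStYOfRecordV7 N θ Mstar' 𝔢₀) 𝔴 𝔈 x).GivenBy3185)
      (fun x => (opsYStOfRecordV4PE N θ Mstar' 𝔯 (sectEStYOfRecordV7 N θ Mstar' 𝔢₀) 𝔴 𝔈 x).HasRWExpC) :=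
  t315_opsYSectESt_sectEStYOfRecordV7_of_3185_onR N θ Mstar' 𝔢₀ hGR (opsYS349OfLetters N θ Mstar' (lettersYOfRecordV4P N θ Mstar' 𝔯) 𝔈)
    (lettersYOfRecordV4P N θ Mstar' 𝔯) 𝔴 ha₀ hδ₁ hB₁ h

end RecordKeyed

/-! ## §6 THE HONESTY GUARD: at the FLAT star letters the displayed (3.185)-side hypotheses are inhabited by the typing alone -/

section FlatGuard

variable (x : MemberY d ℓ hd hL b₀ b₁ Mstar) (𝔏 : CovLettersY 𝔸 x)

/-- at the flat star letters the left outer factor is `P_Λ^st·1·P_Λ^st`. [cite: Balaban1985BackgroundPropagators, (3.185) p.432, bookkeeping] -/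
theorem outerLstY_flat (U : CfgY 𝔸 x.toKIdx) :
    outerLstY x (sectELettersStY_flat 𝔸 x) U = secY 𝔸 (inΛstY x) * (1 : Module.End ℂ (IBondY x.toKIdx → 𝔸)) * secY 𝔸 (inΛstY x) := by
  show secΛstY 𝔸 x * (1 + (0 : (SiteY x.toKIdx → 𝔸) →ₗ[ℂ] (IBondY x.toKIdx → 𝔸)) ∘ₗ (0 : (IBondY x.toKIdx → 𝔸) →ₗ[ℂ] (SiteY x.toKIdx → 𝔸))) *
    secΛstY 𝔸 x = _
  rw [LinearMap.zero_comp, add_zero]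
  rfl

/-- … and so is the right outer factor. [cite: Balaban1985BackgroundPropagators, (3.185) p.432, bookkeeping] -/
theorem outerRstY_flat (U : CfgY 𝔸 x.toKIdx) :
    outerRstY x (sectELettersStY_flat 𝔸 x) U = secY 𝔸 (inΛstY x) * (1 : Module.End ℂ (IBondY x.toKIdx → 𝔸)) * secY 𝔸 (inΛstY x) := by
  show secΛstY 𝔸 x * (1 + (0 : (SiteY x.toKIdx → 𝔸) →ₗ[ℂ] (IBondY x.toKIdx → 𝔸)) ∘ₗ (0 : (IBondY x.toKIdx → 𝔸) →ₗ[ℂ] (SiteY x.toKIdx → 𝔸))) *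
    secΛstY 𝔸 x = _
  rw [LinearMap.zero_comp, add_zero]
  rfl

/-- at the flat star letters the middle factor vanishes (`G̃₂ := 0`). [cite: Balaban1985BackgroundPropagators, (3.186) p.432, bookkeeping] -/
theorem midSstY_flat (U : CfgY 𝔸 x.toKIdx) : midSstY x 𝔏 (sectELettersStY_flat 𝔸 x) U = 0 := by
  show QY x.toKIdx 𝔏.parB U ∘ₗ (0 : (FBondY x.toKIdx → 𝔸) →ₗ[ℂ] (FBondY x.toKIdx → 𝔸)) ∘ₗ QsY x.toKIdx 𝔏.parB U = 0
  rw [LinearMap.zero_comp, LinearMap.comp_zero]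

variable [FiniteDimensional ℂ 𝔸]

/-- blocks of `P_Λ^st·1·P_Λ^st`: range `0`, row and column mass `≦ 1`. [cite: Balaban1985BackgroundPropagators, (3.185) p.432, bookkeeping] -/
theorem blockCLM_secSt_one_secSt (p q : IBondY x.toKIdx) :
    (blockCLM (secY 𝔸 (inΛstY x) * (1 : Module.End ℂ (IBondY x.toKIdx → 𝔸)) * secY 𝔸 (inΛstY x)) p q ≠ 0 → unitDistY x p q ≤ 0) ∧
      (∑ q', ‖blockCLM (secY 𝔸 (inΛstY x) * (1 : Module.End ℂ (IBondY x.toKIdx → 𝔸)) * secY 𝔸 (inΛstY x)) p q'‖ ≤ 1) ∧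
      (∑ p', ‖blockCLM (secY 𝔸 (inΛstY x) * (1 : Module.End ℂ (IBondY x.toKIdx → 𝔸)) * secY 𝔸 (inΛstY x)) p' q‖ ≤ 1) := by
  refine ⟨fun h => ?_, ?_, ?_⟩
  · have h1 := blockCLM_ne_zero_of_sec_sandwich (inΛstY x) (1 : Module.End ℂ (IBondY x.toKIdx → 𝔸)) h
    rw [← blockCLM₂_eq_blockCLM] at h1
    exact range_one (isPseudoDist_unitDistY x) id p q h1
  · calc ∑ q', ‖blockCLM (secY 𝔸 (inΛstY x) * (1 : Module.End ℂ (IBondY x.toKIdx → 𝔸)) * secY 𝔸 (inΛstY x)) p q'‖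
        ≤ ∑ q', ‖blockCLM₂ (1 : Module.End ℂ (IBondY x.toKIdx → 𝔸)) p q'‖ :=
          Finset.sum_le_sum fun q' _ => norm_blockCLM_sec_sandwich_le (inΛstY x) (1 : Module.End ℂ (IBondY x.toKIdx → 𝔸)) p q'
      _ ≤ 1 := rowMass_one_le p
  · calc ∑ p', ‖blockCLM (secY 𝔸 (inΛstY x) * (1 : Module.End ℂ (IBondY x.toKIdx → 𝔸)) * secY 𝔸 (inΛstY x)) p' q‖
        ≤ ∑ p', ‖blockCLM₂ (1 : Module.End ℂ (IBondY x.toKIdx → 𝔸)) p' q‖ :=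
          Finset.sum_le_sum fun p' _ => norm_blockCLM_sec_sandwich_le (inΛstY x) (1 : Module.End ℂ (IBondY x.toKIdx → 𝔸)) p' q
      _ ≤ 1 := colMass_one_le q

/-- **at the flat star letters the outer locality holds for every `r ≧ 0`, `m_E, m_F ≧ 1` and every `U`** (inhabitation by the typing).
[cite: Balaban1985BackgroundPropagators, (3.169) p.430, bookkeeping] -/
theorem localOuterStY_flat (U : CfgY 𝔸 x.toKIdx) {r mE mF : ℝ} (hr : 0 ≤ r) (hmE : 1 ≤ mE) (hmF : 1 ≤ mF) :
    LocalOuterStY x (sectELettersStY_flat 𝔸 x) r mE mF U := by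
  refine ⟨fun p q h => ?_, fun p => ?_, fun q p h => ?_, fun p => ?_⟩
  · rw [outerLstY_flat] at h
    exact ((blockCLM_secSt_one_secSt x p q).1 h).trans hr
  · rw [outerLstY_flat]; exact ((blockCLM_secSt_one_secSt x p p).2.1).trans hmE
  · rw [outerRstY_flat] at h
    exact ((blockCLM_secSt_one_secSt x q p).1 h).trans hr
  · rw [outerRstY_flat]; exact ((blockCLM_secSt_one_secSt x p p).2.2).trans hmF

/-- **at the flat star letters the restricted middle decay holds for every `B₁ ≧ 0`, `δ`, `U`** (the middle factor is `0`).
[cite: Balaban1985BackgroundPropagators, (3.186) p.432, bookkeeping] -/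
theorem decayMidOnStY_flat (U : CfgY 𝔸 x.toKIdx) {B₁ : ℝ} (hB₁ : 0 ≤ B₁) (δ : ℝ) : DecayMidOnStY x 𝔏 (sectELettersStY_flat 𝔸 x) B₁ U δ := by
  intro p q _ _
  rw [midSstY_flat]
  have h0 : blockCLM (0 : Module.End ℂ (IBondY x.toKIdx → 𝔸)) p q = 0 := by ext a; rfl
  rw [h0, norm_zero]
  positivity

/-- ★ **THE HONESTY GUARD, STAR EDITION**: at the FLAT star letters `sectELettersStY_flat` the three (3.185)-side conjuncts displayed by
`thm315FullPrinted_sectESt_of_3185_on[R]` — the star (3.185) identity (`givenBy3185stY_flat`), the outer locality and the restricted middle decay — hold for EVERY `U`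
(`r = 0`, `m_E = m_F = 1`, any `B₁ ≧ 0`): the schema is inhabited by the typing, and (the kernel `CkStY` being `0` there) carries content exactly with GENUINE star letters
(part 3's record `Node00.OpsYSectEElimStar`). [cite: Balaban1985BackgroundPropagators, Thm 3.15 (3.185)–(3.187) p.432, bookkeeping] -/
theorem hyps3185st_flat (U : CfgY 𝔸 x.toKIdx) {B₁ : ℝ} (hB₁ : 0 ≤ B₁) (δ : ℝ) :
    givenBy3185stY x 𝔏 (sectELettersStY_flat 𝔸 x) U ∧ LocalOuterStY x (sectELettersStY_flat 𝔸 x) 0 1 1 U ∧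
      DecayMidOnStY x 𝔏 (sectELettersStY_flat 𝔸 x) B₁ U δ :=
  ⟨givenBy3185stY_flat x 𝔏 U, localOuterStY_flat x U le_rfl le_rfl le_rfl, decayMidOnStY_flat x 𝔏 U hB₁ δ⟩

end FlatGuard

end Literature.MathematicalPhysics.QuantumFieldTheory.Balaban1983to89.B9Thm315SectEStarRepAtLettersR

end
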